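import Literature.MathematicalPhysics.QuantumFieldTheory.Balaban1983to89.B8Eq143PlaqExpansion

/-!
# `Balaban1983to89.B8Eq146AExpansion` — B8 Sect. C (1.46)–(1.49): the expansion in `A` of `∂_{U₀}U₁` and of the
# correction terms of (1.45) for `U₁ = e^{iηA}`, with the printed constants `4`, `3`, `2`, `(1/2!)(·)² ↦ 8`,
# `28d`, `(1/3!)(·)³`, `(4³/3)d` and the polynomial `V₂`

CITATION HEADER (lean-in-tree rule 2026-08-18).  Kernel certificate written by the B08 owner lineage
(`b2b-balaban-b08`, generation 24) of the audit cell `pub-balaban` for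

* **B8** = T. Bałaban, *Spaces of regular gauge field configurations on a lattice and gauge fixing conditions*,
  Commun. Math. Phys. **99** (1985) 75–102 [cite key `Balaban1985RegularSpaces`; printed page = PDF page + 74;
  renders READ AS IMAGES by this unit: `1985-cmp99-regular-spaces-gauge-fixing-p009/p010/p011-x4.png` = printed
  pp. 83, 84, 85],
* with the plaquette derivative and the orientation convention of **B9** = T. Bałaban, *Propagators for lattice
  gauge theories in a background field*, Commun. Math. Phys. **99** (1985) 389–434 = reference [4] of B8 [cite key
  `Balaban1985BackgroundPropagators`; printed page = PDF page + 388; render READ AS IMAGE: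
  `1985-cmp99-background-propagators-p003-x4.png` = printed p. 391, (3.4)–(3.5)],

on top of the parent module `B8Eq143PlaqExpansion` ((1.22) `covPlaq`/`covPlaqF` = `∂_{U₀}U₁`, the divergence
`pdiv` = (1.2) of a plaquette function, the correction summand `corr` and the EXACT identity (1.45)
`eq145_covPlaq`) and its carriers (`B8Ineq132.covDeriv` = (1.1), `covDerivFwd`, `B7Eq78Linearization.conjR` =
`R(U)X = UXU⁻¹`, `B8Lemma1NonAbelian.mulCfg` = `U₁U₀`, `B7Prop1Explicit.expUnit`/`expRem`/`U1`).  Nothing in this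
module is cited FROM the manuscript as a fact: the displayed (1.49) and B9 (3.4) enter only as DEFINITIONS (`V2`,
`plaqCovDeriv`), and every `theorem` is kernel-proved — the ABSOLUTE RULE of the cell (no internally-minted statement
enters as a cited fact; the manuscript under audit is not citable for its own steps).  Both papers are UNDER
ADJUDICATION by the cell; nothing of them is asserted here.

v1.0.1 (2026-08-19, generation 25 of the same lineage; DOCFIX, module docstring ONLY — every declaration below is
byte-identical to v1 = proposal p191551): the three reconstruction-as-quotation passages of the v1 header flagged by
the cell's boundary referee (GAPS G-ref1-28, REFEREE R233.3) and by the cross-read of v1 (GAPS C-pv19g13-2, objection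
O-1 = M1–M3) are taken out of the guillemets, the renders p010/p011 re-read as images: (M1) between (1.46) and
(1.47) print reads «Let us consider the first term on the right-hand side of the above equality. We expand it in A
up to the third order and we get» — v1 had «Now … of (1.46). We have» plus the exponential-product display, which
is OUR `covPlaqF_expCfg` ((1.22) with (1.41)), now marked as such outside the quotation; (M2) p. 84 ends at (1.48)
and p. 85 opens «We find easily the polynomial V₂:» — v1's bridging sentence «Let us write an explicit expression
for V₂. Denoting A(x, y) = x₁, … we have» was OUR dictionary (census C-B8-10), now outside the quotation; (M3) the
display (1.49) is quoted as printed — two members, in full letters — and the x₁…x₄ transcription with the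
intermediate member `(Σxᵢ)² + Σ_{i<j}[xᵢ, xⱼ]` (the kernel theorem `V2_eq_sq_add_commutators`) is marked as ours;
(I-1 of the cross-read) p. 83's sentence on `α₀ + α₁` is quoted in full.  The mathematics, the Dictionary and the
certificates (GAPS C-B8-52) are unaffected.

## The printed texts (verbatim, from the renders)

* B8 p. 83 [PDF 9], (1.41): «U₁ = e^{iηA}, |A| < α₂(Lʲη)⁻¹ on Ω_j, (1.41)» (and (1.42) «R(U₀)D^{η*}_{U₀}A = 0,
  Q_j(U₀, ηA) = B on Λ_j, |B| < 2dLα₁, (1.42)» — print's letter `B` there is the averaged field; it is NOT the `B`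
  of this module, see the Dictionary).
* B8 p. 84 [PDF 10] (after (1.45), quoted in the parent module): «We expand R(U₁(x, x − ηe_ν)) − 1 in A. Because
  ∂_{U₀}U₁ − 1 = O₁(4α₂(Lʲη)⁻¹η), so it is enough to consider a term of the first order, a remainder is
  O₁(3|ηA|²) = O₁(3α₂²(Lʲη)⁻²η²). The term of the first order is iη ad_{A(x,x−ηe_ν)} = O₁(2α₂(Lʲη)⁻¹η). Similarly,
  if we take this term and expand ∂_{U₀}U₁ − 1, then it is enough to consider a term of the first order only, a
  remainder is O₁((1/2!)η²(∂|A|(p))²) = O₁(8α₂²(Lʲη)⁻²η²). The term of the first order is iη²(D^η_{U₀}A)(p). This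
  gives
  (D^{η*}_{U₁U₀}∂_{U₀}U₁)(x, x + ηe_μ) = (D^{η*}_{U₀}(∂_{U₀}U₁ − 1))(x, x + ηe_μ)
     + η² Σ_{ν≠μ} R(U₀(x, x − ηe_ν)) ad_{A(x,x−ηe_ν)}(D^η_{U₀}A)(p_{μν}(x − ηe_ν)) + O₁(28dα₂³(Lʲη)⁻³η²). (1.46)
  Let us consider the first term on the right-hand side of the above equality. We expand it in A up to the
  third order and we get
  (∂_{U₀}U₁)(p) − 1 = iη²(D^η_{U₀}A)(p) − ½η²V₂(U₀, A, ∂p) + O₁((1/3!)η³(∂|A|(p))³), (1.47)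
  where V₂ is a polynomial of the second order in A. Thus
  D^{η*}_{U₀}(∂_{U₀}U₁ − 1) = iη²D^{η*}_{U₀}D^η_{U₀}A − ½η²D^{η*}_{U₀}V₂(U₀, A) + O₁((4³/3)dα₂³(Lʲη)⁻³η²). (1.48)»
  (p. 84 ends here).  [NOT print — ours: the «first term» being expanded is, by (1.22) with (1.41),
  `(∂_{U₀}U₁)(p) = e^{iηA(x, y)}·e^{iηR(U₀(x, y))A(y, z)}·e^{iηR(U₀(x, w))A(z, w)}·e^{iηA(w, x)}` for `p = ⟨x, y, z, w⟩`
  — the kernel lemma `covPlaqF_expCfg` below, not a printed display of pp. 83–85.]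
* B8 p. 85 [PDF 11], (1.49) (the page opens with it): «We find easily the polynomial V₂:
  V₂(U₀, A, ∂p) = (A(x, y))² + 2A(x, y)R(U₀(x, y))A(y, z) + 2A(x, y)R(U₀(x, w))A(z, w) + 2A(x, y)A(w, x)
  + (R(U₀(x, y))A(y, z))² + 2R(U₀(x, y))A(y, z)R(U₀(x, w))A(z, w) + 2R(U₀(x, y))A(y, z)A(w, x)
  + (R(U₀(x, w))A(z, w))² + 2R(U₀(x, w))A(z, w)A(w, x) + (A(w, x))²
  = η²((D^η_{U₀}A)(p))² + {[A(x, y), R(U₀(x, y))A(y, z)] + [A(x, y), R(U₀(x, w))A(z, w)] + [A(x, y), A(w, x)]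
  + [R(U₀(x, y))A(y, z), R(U₀(x, w))A(z, w)] + [R(U₀(x, y))A(y, z), A(w, x)] + [R(U₀(x, w))A(z, w), A(w, x)]}.
  (1.49)  This equality holds for arbitrary A in the complexified Lie algebra, …».
  [NOT print — our shorthand (the Dictionary below; cell census GAPS C-B8-10): x₁ = A(x, y), x₂ = R(U₀(x, y))A(y, z),
  x₃ = R(U₀(x, w))A(z, w), x₄ = A(w, x); in it (1.49) reads V₂ = x₁² + x₂² + x₃² + x₄² + 2(x₁x₂ + x₁x₃ + x₁x₄ + x₂x₃
  + x₂x₄ + x₃x₄) = η²((D^η_{U₀}A)(p))² + Σ_{i<j}[xᵢ, xⱼ], and the intermediate form (x₁ + x₂ + x₃ + x₄)² + Σ_{i<j}[xᵢ, xⱼ]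
  is the kernel theorem `V2_eq_sq_add_commutators` (tree `B8.v2_identity`), not a printed member of the display.]
* B9 p. 391 [PDF 3]: «For a function A defined at bonds of the lattice we put
  (D^η_{U₀}A)(p) = η⁻¹(A(x, y) + R(U₀(x, y))A(y, z) + R(U₀(x, w))A(z, w) + A(w, x)) (3.4) for a plaquette
  p = ⟨x, y, z, w⟩, and if p = p_{μν}(x) = ⟨x, x + ηe_μ, x + ηe_μ + ηe_ν, x + ηe_ν⟩, then we have
  (D^η_{U₀}A)(p_{μν}(x)) = (D^η_{U₀}A)_{μν}(x) = (D^η_{U₀,μ}A_ν)(x) − (D^η_{U₀,ν}A_μ)(x).  We have made here the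
  identification A(x, x + ηe_μ) = A_μ(x).» … «We always make this assumption about gauge field configurations,
  i.e., U(x, x′) = U⁻¹(x′, x), A(x, x′) = −A(x′, x) for a bond ⟨x, x′⟩. (3.5)».

## Dictionary (the `ℤ^d` model of `B7Prop1Explicit` / `B8Ineq132` / `B8Eq143PlaqExpansion`)

Sites `Site d = Fin d → ℤ` (the lattice spacing is the explicit `η > 0` of (1.1)), bond fields `Site d → Fin d → 𝔸`
(exponents) and `Site d → Fin d → 𝔸ˣ` (configurations) over a complete normed `ℂ`-algebra `𝔸` with `‖1‖ = 1` (so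
`M_N(ℂ)`); `A y κ = A(y, y + e_κ)` («A(x, x + ηe_μ) = A_μ(x)») and `A(x′, x) = −A(x, x′)` by (3.5); the background
`U₀` is `U1`-valued (`U1 𝔸 = {u : ‖u‖ ≤ 1, ‖u⁻¹‖ ≤ 1}` ⊇ `U(N)`).  For `p = p_{μν}(x) = ⟨x, y, z, w⟩`:
* **`B`** : `Site d → Fin d → 𝔸` = a GENERAL exponent field, `U₁ = e^{B}` ↦ `expCfg B` (`(expCfg B) y κ =
  expUnit (B y κ)`); print's (1.41) is `B = iηA` ↦ `iEta η A` (`= fun y κ => (iη) • A y κ`, §6).  This `B` is NOT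
  print's averaged field `B = Q_j(U₀, ηA)` of (1.42);
* our four shorthand variables for the summands in (1.49) (census C-B8-10; print writes them in full letters),
  for the exponent field `B`: `x₁ = B(x, y)` ↦ `X1 B μ x = B x μ`,
  `x₂ = R(U₀(x, y))B(y, z)` ↦ `X2 U₀ B μ ν x`, `x₃ = R(U₀(x, w))B(z, w) = −R(U₀(x, w))B(w, z)` ↦ `X3 U₀ B μ ν x`,
  `x₄ = B(w, x) = −B(x, w)` ↦ `X4 B ν x`;  `Σᵢxᵢ` ↦ **`lin U₀ B μ ν x`**;  `½Σᵢxᵢ² + Σ_{i<j}xᵢxⱼ` (the second-order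
  term of `e^{x₁}e^{x₂}e^{x₃}e^{x₄}`) ↦ **`quad U₀ B μ ν x`**;  (1.49) first member, verbatim ↦ **`V2 U₀ A μ ν x`**;
  `[X, Y]`, `ad_X Y` ↦ `adR X Y = XY − YX`;
* `(D^η_{U₀}A)(p_{μν}(x))` of (3.4) ↦ **`plaqCovDeriv η U₀ A μ ν x = η⁻¹ • lin U₀ A μ ν x`** (= `D^η_{U₀,μ}A_ν −
  D^η_{U₀,ν}A_μ` with the tree's forward derivative `covDerivFwd`: `plaqCovDeriv_eq_covDerivFwd`);
* `(∂_{U₀}U₁)(p)` ↦ `covPlaqF U₀ (expCfg B) μ ν x` (parent module), `D^{η*}_{U}` on plaquette functions ↦ `pdiv η U`,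
  the `ν`-th correction summand of (1.45) ↦ `corr η U₀ U₁ ν G x`, `R(U₁(x, x − e_ν))Y = e^{−b}Ye^{b}`,
  `b = B(x − e_ν, ν)` (`conjR_expCfg_inv`);
* the main term of (1.46) ↦ **`main146 η U₀ B μ x = Σ_{ν≠μ} η⁻¹R(U₀(x, x − e_ν)) ad_{b_ν}(Σᵢxᵢ)(p_{μν}(x − e_ν))`**,
  which at `B = iηA` is print's `η²Σ_{ν≠μ}R(U₀(x, x − ηe_ν)) ad_{A(x,x−ηe_ν)}(D^η_{U₀}A)(p_{μν}(x − ηe_ν))` with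
  `A(x, x − ηe_ν) = −A_ν(x − ηe_ν)` (`main146_printed`);
* smallness: `|B_b| ≤ a` on all bonds; in print's units `a = ηα₂(Lʲη)⁻¹` (`|A| ≤ α₂(Lʲη)⁻¹`, `norm_iEta_le`), and
  `∂|B|(p)` ↦ `bdry B μ ν x = |B(x,y)| + |B(y,z)| + |B(w,z)| + |B(x,w)|`;
* remainders: `ρ(t) = e^t − 1 − t` (tree `expRem`), `ρ₃(t) = e^t − 1 − t − t²/2` (`expRem3`), the per-direction
  error of (1.46) `Φ(a) = 2aρ(4a) + ρ(2a)(e^{4a} − 1)` (`phi146`).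

## What is certified (kernel, `sorry`-free; axioms `propext` / `Classical.choice` / `Quot.sound`)

§0–§1 [folklore] real Taylor bookkeeping (`expRem3_add`, polynomial bounds `exp_le_taylor2/3/4`, `ρ(t) ≤ ¾t²`,
`ρ(t) ≤ t²/2 + (2/9)t³`, `ρ₃(t) ≤ (t³/3!)(1 + 5t/16)` on `[0, 1]`) and SECOND-ORDER TAYLOR DATA in a Banach algebra:
`T2 P L Q s` (`|L| ≤ s`, `|P − 1| ≤ e^s − 1`, `|P − 1 − L| ≤ ρ(s)`, `|P − 1 − L − Q| ≤ ρ₃(s)`) is multiplicative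
(`T2.mul`, with `L = L₁ + L₂`, `Q = Q₁ + L₁L₂ + Q₂`, `s = s₁ + s₂`) and holds for `e^B` (`T2.exp`: `L = B`,
`Q = ½B²`, termwise from the exponential series).  §2 the objects above; **(1.49), second line** as an identity
(`V2_eq_sq_add_commutators`: `V₂ = (Σxᵢ)² + Σ_{i<j}[xᵢ, xⱼ]`, from the tree's `B8.v2_identity`), `V₂ = 2·quad`
(`V2_eq_two_smul_quad`), antisymmetry `lin U₀ B ν μ x = −lin U₀ B μ ν x` (`lin_swap`), homogeneity (`lin_smul`,
`quad_smul`) and (3.4) ⟷ `D_μA_ν − D_νA_μ` (`plaqCovDeriv_eq_covDerivFwd`).  §3 **(1.47)** for a GENERAL exponent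
field: `(∂_{U₀}e^B)(p) = e^{x₁}e^{x₂}e^{x₃}e^{x₄}` (`covPlaqF_expCfg`, from the parent's `lead·trail`) has the Taylor
data `(Σxᵢ, quad, ∂|B|(p))` (`taylor_covPlaqF`), hence `|(∂_{U₀}U₁)(p) − 1 − Σxᵢ − quad| ≤ ρ₃(∂|B|(p))` (`eq147`),
`|(∂_{U₀}U₁)(p) − 1 − Σxᵢ| ≤ ρ(∂|B|(p))` (`eq147_ord1`), `|(∂_{U₀}U₁)(p) − 1| ≤ e^{4a} − 1`
(`norm_covPlaqF_expCfg_sub_one_le`).  §4 **(1.46)**: «We expand R(U₁(x, x − ηe_ν)) − 1»: `|e^{−b}Ye^{b} − Y| ≤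
(e^{2β} − 1)|Y|`, `|e^{−b}Ye^{b} − Y − (Yb − bY)| ≤ ρ(2β)|Y|` for `|b| ≤ β` (`conj_exp_expansion`); the `ν`-th
correction term minus `η⁻¹R(U₀(x, x − e_ν))(Lb − bL)` is `≤ η⁻¹(2|b|·|Z − L| + ρ(2β)|Z|)` for ANY first-order proxy
`L` of `Z = (∂_{U₀}U₁)(p′) − 1` (`norm_corr_sub_main_le` — «it is enough to consider a term of the first order»),
and, summing (1.45) over the `d − 1` directions `ν ≠ μ` with `L = Σᵢxᵢ(p′)` and `lin_swap` for `ν < μ`: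
**`eq146`**: `|D^{η*}_{U₁U₀}∂_{U₀}U₁(x, x + e_μ) − D^{η*}_{U₀}(∂_{U₀}U₁ − 1)(x, x + e_μ) − main146| ≤ (d − 1)η⁻¹Φ(a)`,
with `Φ(a) ≤ 28a³` for `16a ≤ 1` (`phi146_le`).  §5 **(1.48)** (sharp): `|D^{η*}_{U₀}(∂_{U₀}U₁ − 1)_μ(x) −
D^{η*}_{U₀}(Σᵢxᵢ)_μ(x) − D^{η*}_{U₀}(quad)_μ(x)| ≤ 2(d − 1)η⁻¹ρ₃(4a)` (`eq148`, by `pdiv_add` and `norm_covDeriv_le`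
of the parent).  §6 PRINT'S LETTERS AND CONSTANTS at `B = iηA`, `|A| ≤ α₂(Lʲη)⁻¹`, `a = ηα₂(Lʲη)⁻¹`:
`Σᵢxᵢ = iη²(D^η_{U₀}A)(p)` (`lin_printed`), `quad = −½η²V₂(U₀, A, ∂p)` (`quad_printed`) — so the two subtracted
terms ARE print's `iη²D^{η*}_{U₀}D^η_{U₀}A` and `−½η²D^{η*}_{U₀}V₂` (`pdiv_smul`, `lin_quad_iEta`); «∂_{U₀}U₁ − 1 =
O₁(4α₂(Lʲη)⁻¹η)»: `≤ 4a(1 + 3a)` for `4a ≤ 1` (`norm_covPlaqF_sub_one_printed`); «a remainder is O₁(3|ηA|²)»: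
`|(R(U₁(x, x − e_ν)) − 1)Y − iη ad_{A(x,x−e_ν)}Y| ≤ 3(η|A_b|)²|Y|` for `2η|A_b| ≤ 1` (`expansion_R_printed` — print's
`3` EXACTLY); «iη ad_{A(x,x−ηe_ν)} = O₁(2α₂(Lʲη)⁻¹η)»: `first_order_R_printed` (print's `2` EXACTLY);
«O₁((1/2!)η²(∂|A|(p))²)»: `≤ (s²/2!)(1 + 4s/9)`, `s = η∂|A|(p) ≤ 1` (`eq147_ord1_printed`); **(1.46) with `28d`**:
`eq146_printed` — `|… − η²Σ_{ν≠μ}R(U₀(x, x − ηe_ν)) ad_{A(x,x−ηe_ν)}(D^η_{U₀}A)(p_{μν}(x − ηe_ν))| ≤ 28dα₂³(Lʲη)⁻³η²`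
under `16ηα₂(Lʲη)⁻¹ ≤ 1` (print's `28d` EXACTLY, `(d − 1) ≤ d`; `main146_printed` certifies print's `+` sign);
**(1.47) with `1/3!`**: `eq147_printed` — `|(∂_{U₀}U₁)(p) − 1 − iη²(D^η_{U₀}A)(p) + ½η²V₂| ≤ (s³/3!)(1 + 5s/16)`,
`s = η∂|A|(p) ≤ 1`; **(1.48) with `(4³/3)d`**: `eq148_unif` (`≤ (4³/3)(d − 1)(1 + 5a/4)α₂³(Lʲη)⁻³η²`, `4a ≤ 1`) and
`eq148_printed` (`≤ (4³/3)dα₂³(Lʲη)⁻³η²` under `4a ≤ 1 ∧ 5a(d − 1) ≤ 4`; the unit bookkeeping `units146`).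
So the constants `4`, `3`, `2`, `8 = (1/2!)·4²`, `28 = 2·8 + 3·4`, `1/3!`, `4³/3 = 2·(1/3!)·4³` of p. 84 —
hand-certified in the cell's census (GAPS C-B8-10) — are now KERNEL facts of the model, in the precise forms listed.

## HONEST SCOPE — what is NOT claimed

(i) `U₀` is assumed `U1`-valued (unitary background); the exponent field `B` is ARBITRARY in `𝔸` («This equality
holds for arbitrary A in the complexified Lie algebra», p. 85) — `U₁ = e^B` is NOT assumed unitary and no bound
`|U₁| ≤ 1` is used: every `U₁`-estimate is derived from `|B_b| ≤ a` through the exponential series, which is why the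
sharp forms carry `e^{4a} − 1`, `ρ(2a)`, `ρ(4a)`, `ρ₃(4a)` where print writes the leading Taylor constants.
(ii) Print's constants drop the factors `e^{O(a)}`, `a = ηα₂(Lʲη)⁻¹` (census class remark of C-B8-10; print only
asks, p. 83, «We expect that we have to assume that α₀ + α₁ is sufficiently small.»): `3` and `2` are
certified EXACTLY (`ρ(2t) ≤ 3t²` for `2t ≤ 1`); `4`, `8 = (1/2!)4²`,
`1/3!` are certified as `4a(1 + 3a)`, `(s²/2!)(1 + 4s/9)`, `(s³/3!)(1 + 5s/16)` (explicit correction factors, `→ 1`);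
`28d` is certified EXACTLY under the explicit smallness `16a ≤ 1` (print's `3|ηA|²`, an overestimate of `ρ(2η|A|)`,
leaves the slack: `Φ(a) = 24a³ + O(a⁴) ≤ 28a³`); `(4³/3)d` is certified EXACTLY only under `4a ≤ 1 ∧ 5a(d − 1) ≤ 4`
(e.g. `d ≤ 13` at `a ≤ 1/16`): here print's only slack is `d` versus the true count `d − 1` of directions, and the
sharp statement `eq148` / `eq148_unif` (factor `1 + 5a/4`) is the one valid for all `d`.  These thresholds are OURS,
not print's.  (iii) The smallness hypotheses are GLOBAL (all bonds) where print localises to `Ω_j` («on Ω_j»); the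
pointwise lemmas (`taylor_covPlaqF`, `norm_corr_sub_main_le`, `conj_exp_expansion`) carry the locality; the region
bookkeeping (1.3)–(1.5) is not repeated.  (iv) SIGN OF (1.46): with (3.5) of [B9] (`A(x, x − ηe_ν) = −A(x − ηe_ν, x)
= −A_ν(x − ηe_ν)`, forced by `U₁(x′, x) = U₁(x, x′)⁻¹` for `U₁ = e^{iηA}`) the kernel identity `main146_printed`
reproduces print's `+η²Σ_{ν≠μ}R(U₀(x, x − ηe_ν)) ad_{A(x,x−ηe_ν)}(…)`; the census aside of GAPS C-B8-10 («the sign of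
the η²Σ ad-term in (1.46) should be "−"») read `A(x, x − ηe_ν)` as `+A_ν(x − ηe_ν)` and is WITHDRAWN by the erratum
row GAPS C-B8-52 (immaterial downstream either way: only `|ad_{A}| ≤ 2|A|` is used in B8).  (v) Print's strict `<`
are certified as `≤` from `≤`-hypotheses.  (vi) NOT typed here: (1.42) and the use of `R(U₀)D^{η*}_{U₀}A = 0`
((1.36)) to kill `iη²D^{η*}_{U₀}D^η_{U₀}A` after projection, (1.50)–(1.54) (the bounds `48d`, `32d` on `D^{η*}V₂` and
the final (1.54)) — the tree's `B8.commutators_150` is the ring identity behind (1.50) only.  (vii) Nothing here is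
progress on the summit `Summit.QuantumFields` — the value is a kernel section certificate for B8 (1.46)–(1.49).
-/

noncomputable section

open scoped BigOperators
open NormedSpace Finset

namespace Literature.MathematicalPhysics.QuantumFieldTheory.Balaban1983to89.B8Eq146AExpansion

open B7Prop1Explicit
open B7Eq78Linearization (conjR conjR_apply conjR_one conjR_add conjR_sub conjR_smul conjR_smul_real)
open B8Lemma1NonAbelian (mulCfg)
open B8Ineq132 (plaqF covDeriv covDerivFwd covDiv conjR_conjR one_conjR conjR_sum conjR_units norm_conjR_le
  norm_conjR)
open B8Eq143PlaqExpansion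

-- `Site` alone would resolve to the torus sites of `Setup.lean`; re-export the `ℤ^d` sites of `B7Prop1Explicit`.
export B7Prop1Explicit (Site)

variable {d : ℕ}

/-! ## §0 Real bookkeeping: the third-order remainder `ρ₃(t) = e^t − 1 − t − t²/2` and the numerical Taylor bounds -/

section RealTaylor

/-- `ρ₃(t) = e^t − 1 − t − t²/2`, the universal third-order remainder (the tree's `expRem t = e^t − 1 − t` is the
second-order one). [folklore] -/
def expRem3 (t : ℝ) : ℝ := Real.exp t - 1 - t - t ^ 2 / 2

/-- `ρ₃ ≥ 0` on `[0, ∞)`. [folklore] -/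
theorem expRem3_nonneg {t : ℝ} (ht : 0 ≤ t) : 0 ≤ expRem3 t := by
  have := Real.quadratic_le_exp_of_nonneg ht
  unfold expRem3; linarith

/-- The multiplicative bookkeeping of third-order remainders:
`ρ₃(a + b) = ρ₃(a) + ρ₃(b) + ρ(a)(e^b − 1) + a·ρ(b)`. [folklore] -/
theorem expRem3_add (a b : ℝ) :
    expRem3 (a + b) = expRem3 a + expRem3 b + expRem a * (Real.exp b - 1) + a * expRem b := by
  unfold expRem3 expRem; rw [Real.exp_add]; ring

/-- `ρ₃` is monotone on `[0, ∞)`. [folklore] -/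
theorem expRem3_mono {s t : ℝ} (hs : 0 ≤ s) (hst : s ≤ t) : expRem3 s ≤ expRem3 t := by
  have h := expRem3_add s (t - s)
  rw [add_sub_cancel] at h
  have h1 := expRem3_nonneg (sub_nonneg.mpr hst)
  have h2 := expRem_nonneg s
  have h3 : 0 ≤ Real.exp (t - s) - 1 := by have := Real.one_le_exp (sub_nonneg.mpr hst); linarith
  have h4 := expRem_nonneg (t - s)
  nlinarith

/-- `e^t − 1` is monotone. [folklore] -/
theorem exp_sub_one_mono {s t : ℝ} (hst : s ≤ t) : Real.exp s - 1 ≤ Real.exp t - 1 := by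
  have := Real.exp_le_exp.mpr hst; linarith

/-- `e^t ≤ 1 + t + (3/4)t²` on `[0, 1]` (Mathlib `Real.exp_bound'`, `n = 2`). [folklore] -/
theorem exp_le_taylor2 {t : ℝ} (h0 : 0 ≤ t) (h1 : t ≤ 1) : Real.exp t ≤ 1 + t + 3 / 4 * t ^ 2 := by
  have h := Real.exp_bound' h0 h1 (n := 2) (by norm_num)
  simp only [Finset.sum_range_succ, Finset.sum_range_zero, Nat.factorial, pow_zero, pow_one, Nat.cast_one,
    Nat.cast_ofNat] at h
  norm_num at h
  linarith

/-- `e^t ≤ 1 + t + t²/2 + (2/9)t³` on `[0, 1]` (Mathlib `Real.exp_bound'`, `n = 3`). [folklore] -/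
theorem exp_le_taylor3 {t : ℝ} (h0 : 0 ≤ t) (h1 : t ≤ 1) :
    Real.exp t ≤ 1 + t + t ^ 2 / 2 + 2 / 9 * t ^ 3 := by
  have h := Real.exp_bound' h0 h1 (n := 3) (by norm_num)
  simp only [Finset.sum_range_succ, Finset.sum_range_zero, Nat.factorial, pow_zero, pow_one, Nat.cast_one,
    Nat.cast_ofNat] at h
  norm_num at h
  linarith

/-- `e^t ≤ 1 + t + t²/2 + t³/6 + (5/96)t⁴` on `[0, 1]` (Mathlib `Real.exp_bound'`, `n = 4`). [folklore] -/
theorem exp_le_taylor4 {t : ℝ} (h0 : 0 ≤ t) (h1 : t ≤ 1) :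
    Real.exp t ≤ 1 + t + t ^ 2 / 2 + t ^ 3 / 6 + 5 / 96 * t ^ 4 := by
  have h := Real.exp_bound' h0 h1 (n := 4) (by norm_num)
  simp only [Finset.sum_range_succ, Finset.sum_range_zero, Nat.factorial, pow_zero, pow_one, Nat.cast_one,
    Nat.cast_ofNat] at h
  norm_num at h
  linarith

/-- `ρ(t) ≤ (3/4)t²` on `[0, 1]` — print's «O₁(3|ηA|²)» is `ρ(2t) ≤ 3t²`. [folklore] -/
theorem expRem_le_three_quarters {t : ℝ} (h0 : 0 ≤ t) (h1 : t ≤ 1) : expRem t ≤ 3 / 4 * t ^ 2 := by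
  have := exp_le_taylor2 h0 h1; unfold expRem; linarith

/-- `ρ(t) ≤ t²/2 + (2/9)t³` on `[0, 1]`. [folklore] -/
theorem expRem_le_taylor3 {t : ℝ} (h0 : 0 ≤ t) (h1 : t ≤ 1) : expRem t ≤ t ^ 2 / 2 + 2 / 9 * t ^ 3 := by
  have := exp_le_taylor3 h0 h1; unfold expRem; linarith

/-- `e^t − 1 ≤ t + t²/2 + (2/9)t³` on `[0, 1]`. [folklore] -/
theorem exp_sub_one_le_taylor3 {t : ℝ} (h0 : 0 ≤ t) (h1 : t ≤ 1) :
    Real.exp t - 1 ≤ t + t ^ 2 / 2 + 2 / 9 * t ^ 3 := by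
  have := exp_le_taylor3 h0 h1; linarith

/-- `ρ₃(t) ≤ (2/9)t³` on `[0, 1]`. [folklore] -/
theorem expRem3_le_taylor3 {t : ℝ} (h0 : 0 ≤ t) (h1 : t ≤ 1) : expRem3 t ≤ 2 / 9 * t ^ 3 := by
  have := exp_le_taylor3 h0 h1; unfold expRem3; linarith

/-- `ρ₃(t) ≤ (1/3!)t³·(1 + (5/16)t)` on `[0, 1]` — print's `1/3!` with the next Taylor correction explicit.
[folklore] -/
theorem expRem3_le_taylor4 {t : ℝ} (h0 : 0 ≤ t) (h1 : t ≤ 1) :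
    expRem3 t ≤ t ^ 3 / 6 * (1 + 5 / 16 * t) := by
  have := exp_le_taylor4 h0 h1; unfold expRem3; nlinarith

end RealTaylor

/-! ## §1 Second-order Taylor data in a Banach algebra -/

section Taylor

variable {𝔸 : Type*} [NormedRing 𝔸] [NormedAlgebra ℂ 𝔸] [CompleteSpace 𝔸]

/-- SECOND-ORDER TAYLOR DATA: `P = 1 + L + Q + (third order)` with amplitude `s`:
`|L| ≤ s`, `|P − 1| ≤ e^s − 1`, `|P − 1 − L| ≤ ρ(s)`, `|P − 1 − L − Q| ≤ ρ₃(s)` — print's `O₁(·)` bookkeeping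
(«|O₁(α)| ≦ α», p. 84) made exact. [folklore] -/
structure T2 (P L Q : 𝔸) (s : ℝ) : Prop where
  norm_lin : ‖L‖ ≤ s
  ord0 : ‖P - 1‖ ≤ Real.exp s - 1
  ord1 : ‖P - 1 - L‖ ≤ expRem s
  ord2 : ‖P - 1 - L - Q‖ ≤ expRem3 s

namespace T2

variable {P P₁ P₂ L L' L₁ L₂ Q Q' Q₁ Q₂ : 𝔸} {s s' s₁ s₂ t : ℝ}

omit [NormedAlgebra ℂ 𝔸] [CompleteSpace 𝔸] in
/-- The amplitude is nonnegative. [folklore] -/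
theorem nonneg (h : T2 P L Q s) : 0 ≤ s := (norm_nonneg L).trans h.norm_lin

omit [NormedAlgebra ℂ 𝔸] [CompleteSpace 𝔸] in
/-- Monotonicity in the amplitude. [folklore] -/
theorem mono (h : T2 P L Q s) (hst : s ≤ t) : T2 P L Q t where
  norm_lin := h.norm_lin.trans hst
  ord0 := h.ord0.trans (exp_sub_one_mono hst)
  ord1 := h.ord1.trans (expRem_mono h.nonneg hst)
  ord2 := h.ord2.trans (expRem3_mono h.nonneg hst)

omit [NormedAlgebra ℂ 𝔸] [CompleteSpace 𝔸] in
/-- Rewriting the data. [folklore] -/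
theorem congr (h : T2 P L Q s) (hL : L = L') (hQ : Q = Q') (hs : s = s') : T2 P L' Q' s' := by
  subst hL hQ hs
  exact h

omit [NormedAlgebra ℂ 𝔸] [CompleteSpace 𝔸] in
/-- PRODUCTS: `(1 + L₁ + Q₁ + …)(1 + L₂ + Q₂ + …) = 1 + (L₁ + L₂) + (Q₁ + L₁L₂ + Q₂) + …` with amplitude `s₁ + s₂`
— exactly, by `e^{s₁}e^{s₂} = e^{s₁+s₂}`, `ρ(s₁ + s₂) = (e^{s₁} − 1)(e^{s₂} − 1) + ρ(s₁) + ρ(s₂)` and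
`ρ₃(s₁ + s₂) = ρ₃(s₁) + ρ₃(s₂) + ρ(s₁)(e^{s₂} − 1) + s₁ρ(s₂)`. [folklore] -/
theorem mul (h₁ : T2 P₁ L₁ Q₁ s₁) (h₂ : T2 P₂ L₂ Q₂ s₂) :
    T2 (P₁ * P₂) (L₁ + L₂) (Q₁ + L₁ * L₂ + Q₂) (s₁ + s₂) where
  norm_lin := (norm_add_le _ _).trans (add_le_add h₁.norm_lin h₂.norm_lin)
  ord0 := by
    have heq : P₁ * P₂ - 1 = (P₁ - 1) * (P₂ - 1) + (P₁ - 1) + (P₂ - 1) := by noncomm_ring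
    have h0 : 0 ≤ Real.exp s₁ - 1 := by have := Real.one_le_exp h₁.nonneg; linarith
    rw [heq]
    calc _ ≤ ‖(P₁ - 1) * (P₂ - 1)‖ + ‖P₁ - 1‖ + ‖P₂ - 1‖ := norm_add₃_le
      _ ≤ ‖P₁ - 1‖ * ‖P₂ - 1‖ + ‖P₁ - 1‖ + ‖P₂ - 1‖ := by gcongr; exact norm_mul_le _ _
      _ ≤ (Real.exp s₁ - 1) * (Real.exp s₂ - 1) + (Real.exp s₁ - 1) + (Real.exp s₂ - 1) := by
        gcongr
        · exact h₁.ord0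
        · exact h₂.ord0
        · exact h₁.ord0
        · exact h₂.ord0
      _ = Real.exp (s₁ + s₂) - 1 := by rw [Real.exp_add]; ring
  ord1 := by
    have h0 : 0 ≤ Real.exp s₁ - 1 := by have := Real.one_le_exp h₁.nonneg; linarith
    calc _ ≤ ‖P₁ - 1‖ * ‖P₂ - 1‖ + ‖P₁ - 1 - L₁‖ + ‖P₂ - 1 - L₂‖ := norm_mul_sub_one_sub_le _ _ _ _
      _ ≤ (Real.exp s₁ - 1) * (Real.exp s₂ - 1) + expRem s₁ + expRem s₂ := by
        gcongr
        · exact h₁.ord0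
        · exact h₂.ord0
        · exact h₁.ord1
        · exact h₂.ord1
      _ = expRem (s₁ + s₂) := (expRem_add s₁ s₂).symm
  ord2 := by
    have heq : P₁ * P₂ - 1 - (L₁ + L₂) - (Q₁ + L₁ * L₂ + Q₂) =
        (P₁ - 1 - L₁) * (P₂ - 1) + L₁ * (P₂ - 1 - L₂) + (P₁ - 1 - L₁ - Q₁) + (P₂ - 1 - L₂ - Q₂) := by
      noncomm_ring
    have h0 : 0 ≤ Real.exp s₂ - 1 := by have := Real.one_le_exp h₂.nonneg; linarith
    rw [heq]
    calc _ ≤ ‖(P₁ - 1 - L₁) * (P₂ - 1)‖ + ‖L₁ * (P₂ - 1 - L₂)‖ + ‖P₁ - 1 - L₁ - Q₁‖ + ‖P₂ - 1 - L₂ - Q₂‖ := by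
          refine (norm_add_le _ _).trans (add_le_add ((norm_add_le _ _).trans (add_le_add ?_ le_rfl)) le_rfl)
          exact norm_add_le _ _
      _ ≤ ‖P₁ - 1 - L₁‖ * ‖P₂ - 1‖ + ‖L₁‖ * ‖P₂ - 1 - L₂‖ + ‖P₁ - 1 - L₁ - Q₁‖ + ‖P₂ - 1 - L₂ - Q₂‖ := by
          gcongr <;> exact norm_mul_le _ _
      _ ≤ expRem s₁ * (Real.exp s₂ - 1) + s₁ * expRem s₂ + expRem3 s₁ + expRem3 s₂ := by
          gcongr
          all_goals first
            | exact expRem_nonneg _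
            | exact h₁.nonneg
            | exact h₁.ord1
            | exact h₂.ord0
            | exact h₁.norm_lin
            | exact h₂.ord1
            | exact h₁.ord2
            | exact h₂.ord2
      _ = expRem3 (s₁ + s₂) := by rw [expRem3_add]; ring

/-- THE EXPONENTIAL: `e^B = 1 + B + ½B² + O₁(ρ₃(|B|))` — the second-order term is `½B²` and every order is
controlled by the real exponential series at `a ≥ |B|` (termwise comparison, as in the tree's
`norm_exp_sub_one_le_of_norm_le` for the orders 0 and 1). [folklore] -/
theorem exp {B : 𝔸} {a : ℝ} (h : ‖B‖ ≤ a) : T2 (exp B) B ((2 : ℂ)⁻¹ • (B * B)) a where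
  norm_lin := h
  ord0 := (norm_exp_sub_one_le_of_norm_le h).1
  ord1 := (norm_exp_sub_one_le_of_norm_le h).2
  ord2 := by
    have h1 : HasSum (fun n : ℕ => ((n.factorial : ℂ)⁻¹) • B ^ n) (NormedSpace.exp B) :=
      exp_series_hasSum_exp' (𝕂 := ℂ) B
    have h1' : HasSum (fun n : ℕ => (((n + 3).factorial : ℂ)⁻¹) • B ^ (n + 3))
        (NormedSpace.exp B - 1 - B - (2 : ℂ)⁻¹ • (B * B)) := by
      have h' := (hasSum_nat_add_iff' 3).mpr h1
      have heq : ∑ i ∈ Finset.range 3, ((i.factorial : ℂ)⁻¹) • B ^ i = 1 + B + (2 : ℂ)⁻¹ • (B * B) := by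
        simp [Finset.sum_range_succ, Nat.factorial, pow_two]
      rw [heq, ← sub_sub, ← sub_sub] at h'
      exact h'
    have h2 : HasSum (fun n : ℕ => ‖B‖ ^ n / (n.factorial : ℝ)) (Real.exp ‖B‖) := by
      rw [Real.exp_eq_exp_ℝ]
      exact expSeries_div_hasSum_exp ‖B‖
    have h2' : HasSum (fun n : ℕ => ‖B‖ ^ (n + 3) / ((n + 3).factorial : ℝ)) (expRem3 ‖B‖) := by
      have h' := (hasSum_nat_add_iff' 3).mpr h2
      have heq : ∑ i ∈ Finset.range 3, ‖B‖ ^ i / (i.factorial : ℝ) = 1 + ‖B‖ + ‖B‖ ^ 2 / 2 := by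
        simp [Finset.sum_range_succ, Nat.factorial]
      rw [heq] at h'
      have e3 : Real.exp ‖B‖ - (1 + ‖B‖ + ‖B‖ ^ 2 / 2) = expRem3 ‖B‖ := by unfold expRem3; ring
      rw [e3] at h'
      exact h'
    have h3 : ‖NormedSpace.exp B - 1 - B - (2 : ℂ)⁻¹ • (B * B)‖ ≤ expRem3 ‖B‖ :=
      h1'.norm_le_of_bounded h2' fun n => by
        rw [norm_smul, norm_inv, RCLike.norm_natCast, div_eq_inv_mul]
        gcongr
        exact norm_pow_le' B (by omega)
    exact h3.trans (expRem3_mono (norm_nonneg _) h)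

end T2

/-- `e^{R(u)X} = R(u)e^X` (Mathlib `exp_units_conj`; the `ℚ`-algebra structure it asks for is supplied by
restriction of scalars, as in `B7Prop1Explicit.expUnit`). [folklore] -/
theorem exp_conjR (u : 𝔸ˣ) (X : 𝔸) : exp (conjR u X) = conjR u (exp X) := by
  letI : NormedAlgebra ℚ 𝔸 := NormedAlgebra.restrictScalars ℚ ℂ 𝔸
  rw [conjR_apply, conjR_apply]
  exact exp_units_conj u X

end Taylor

/-! ## §2 The objects of pp. 84–85 and of (3.4)–(3.5) of [B9]: `U₁ = e^{B}`, the four variables of (1.49),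
the first- and second-order terms, `V₂`, the plaquette derivative `(D^η_{U₀}A)(p)` and `ad` -/

section Polys

variable {𝔸 : Type*} [NormedRing 𝔸]

/-- `A(x, y)` for `p_{μν}(x) = ⟨x, y, z, w⟩`, `y = x + e_μ` («A(x, x + ηe_μ) = A_μ(x)», (3.4) of [B9]).
[cite: Balaban1985BackgroundPropagators, (3.4) p.391] -/
def X1 (A : Site d → Fin d → 𝔸) (μ : Fin d) (x : Site d) : 𝔸 := A x μ

/-- `R(U₀(x, y))A(y, z)`, `z = y + e_ν`. [cite: Balaban1985RegularSpaces, (1.49) p.85] -/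
def X2 (U₀ : Site d → Fin d → 𝔸ˣ) (A : Site d → Fin d → 𝔸) (μ ν : Fin d) (x : Site d) : 𝔸 :=
  conjR (U₀ x μ) (A (x + e μ) ν)

/-- `R(U₀(x, w))A(z, w)`, `w = x + e_ν`, with `A(z, w) = −A(w, z)` ((3.5) of [B9]: «A(x, x′) = −A(x′, x)»).
[cite: Balaban1985RegularSpaces, (1.49) p.85; Balaban1985BackgroundPropagators, (3.5) p.391] -/
def X3 (U₀ : Site d → Fin d → 𝔸ˣ) (A : Site d → Fin d → 𝔸) (μ ν : Fin d) (x : Site d) : 𝔸 :=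
  conjR (U₀ x ν) (-A (x + e ν) μ)

/-- `A(w, x) = −A(x, w)`, `w = x + e_ν` ((3.5) of [B9]). [cite: Balaban1985BackgroundPropagators, (3.5) p.391] -/
def X4 (A : Site d → Fin d → 𝔸) (ν : Fin d) (x : Site d) : 𝔸 := -A x ν

/-- THE FIRST-ORDER TERM `A(x, y) + R(U₀(x, y))A(y, z) + R(U₀(x, w))A(z, w) + A(w, x) = η(D^η_{U₀}A)(p)` ((3.4) of
[B9]); at `B = iηA` it is print's «iη²(D^η_{U₀}A)(p)». [cite: Balaban1985RegularSpaces, (1.47) p.84;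
Balaban1985BackgroundPropagators, (3.4) p.391] -/
def lin (U₀ : Site d → Fin d → 𝔸ˣ) (A : Site d → Fin d → 𝔸) (μ ν : Fin d) (x : Site d) : 𝔸 :=
  X1 A μ x + X2 U₀ A μ ν x + X3 U₀ A μ ν x + X4 A ν x

/-- **(1.49)** VERBATIM: `V₂(U₀, A, ∂p) = (A(x,y))² + 2A(x,y)R(U₀(x,y))A(y,z) + 2A(x,y)R(U₀(x,w))A(z,w)
+ 2A(x,y)A(w,x) + (R(U₀(x,y))A(y,z))² + 2R(U₀(x,y))A(y,z)R(U₀(x,w))A(z,w) + 2R(U₀(x,y))A(y,z)A(w,x)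
+ (R(U₀(x,w))A(z,w))² + 2R(U₀(x,w))A(z,w)A(w,x) + (A(w,x))²` (ordered products, `2XY` read as `2·(XY)`).
[cite: Balaban1985RegularSpaces, (1.49) p.85] -/
def V2 (U₀ : Site d → Fin d → 𝔸ˣ) (A : Site d → Fin d → 𝔸) (μ ν : Fin d) (x : Site d) : 𝔸 :=
  X1 A μ x * X1 A μ x + 2 * (X1 A μ x * X2 U₀ A μ ν x) + 2 * (X1 A μ x * X3 U₀ A μ ν x)
    + 2 * (X1 A μ x * X4 A ν x) + X2 U₀ A μ ν x * X2 U₀ A μ ν x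
    + 2 * (X2 U₀ A μ ν x * X3 U₀ A μ ν x) + 2 * (X2 U₀ A μ ν x * X4 A ν x)
    + X3 U₀ A μ ν x * X3 U₀ A μ ν x + 2 * (X3 U₀ A μ ν x * X4 A ν x) + X4 A ν x * X4 A ν x

/-- `ad_X Y = [X, Y] = XY − YX`. [cite: Balaban1985RegularSpaces, p.84 («iη ad_{A(x,x−ηe_ν)}»)] -/
def adR (X Y : 𝔸) : 𝔸 := X * Y - Y * X

/-- `|ad_X Y| ≤ 2|X||Y|` — print's «iη ad_{A(x,x−ηe_ν)} = O₁(2α₂(Lʲη)⁻¹η)». [cite: Balaban1985RegularSpaces, p.84] -/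
theorem norm_adR_le (X Y : 𝔸) : ‖adR X Y‖ ≤ 2 * ‖X‖ * ‖Y‖ := by
  unfold adR
  calc _ ≤ ‖X * Y‖ + ‖Y * X‖ := norm_sub_le _ _
    _ ≤ ‖X‖ * ‖Y‖ + ‖Y‖ * ‖X‖ := add_le_add (norm_mul_le _ _) (norm_mul_le _ _)
    _ = 2 * ‖X‖ * ‖Y‖ := by ring

/-- `R(u)(−X) = −R(u)X`. [folklore] -/
theorem conjR_neg (u : 𝔸ˣ) (X : 𝔸) : conjR u (-X) = -conjR u X := by
  simp only [conjR_apply, mul_neg, neg_mul]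

/-- ANTISYMMETRY of the first-order term under `p_{μν} ↔ p_{νμ}`: `(D^η_{U₀}A)(p_{νμ}(x)) = −(D^η_{U₀}A)(p_{μν}(x))`.
[folklore] -/
theorem lin_swap (U₀ : Site d → Fin d → 𝔸ˣ) (A : Site d → Fin d → 𝔸) (μ ν : Fin d) (x : Site d) :
    lin U₀ A ν μ x = -lin U₀ A μ ν x := by
  simp only [lin, X1, X2, X3, X4, conjR_neg]
  abel

/-- The second line of (1.49): `V₂(U₀, A, ∂p) = (Σᵢxᵢ)² + {Σ_{i<j}[xᵢ, xⱼ]}` with `Σᵢxᵢ = η(D^η_{U₀}A)(p)` — the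
tree's free-ring identity `B8.v2_identity` instantiated on the four variables. [cite: Balaban1985RegularSpaces, (1.49) p.85] -/
theorem V2_eq_sq_add_commutators (U₀ : Site d → Fin d → 𝔸ˣ) (A : Site d → Fin d → 𝔸) (μ ν : Fin d)
    (x : Site d) :
    V2 U₀ A μ ν x = lin U₀ A μ ν x * lin U₀ A μ ν x +
      (adR (X1 A μ x) (X2 U₀ A μ ν x) + adR (X1 A μ x) (X3 U₀ A μ ν x) + adR (X1 A μ x) (X4 A ν x)
        + adR (X2 U₀ A μ ν x) (X3 U₀ A μ ν x) + adR (X2 U₀ A μ ν x) (X4 A ν x)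
        + adR (X3 U₀ A μ ν x) (X4 A ν x)) := by
  have h := B8.v2_identity (X1 A μ x) (X2 U₀ A μ ν x) (X3 U₀ A μ ν x) (X4 A ν x)
  simp only [V2, lin, adR]
  rw [← h]
  noncomm_ring

variable [NormedAlgebra ℂ 𝔸]

/-- THE SECOND-ORDER TERM of `e^{X₁}e^{X₂}e^{X₃}e^{X₄}`: `½ΣᵢXᵢ² + Σ_{i<j}XᵢXⱼ` (`= ½V₂`, `V2_eq_two_smul_quad`); at
`B = iηA` it is print's «−½η²V₂(U₀, A, ∂p)». [cite: Balaban1985RegularSpaces, (1.47), (1.49) pp.84-85] -/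
def quad (U₀ : Site d → Fin d → 𝔸ˣ) (A : Site d → Fin d → 𝔸) (μ ν : Fin d) (x : Site d) : 𝔸 :=
  (2 : ℂ)⁻¹ • (X1 A μ x * X1 A μ x + X2 U₀ A μ ν x * X2 U₀ A μ ν x + X3 U₀ A μ ν x * X3 U₀ A μ ν x
      + X4 A ν x * X4 A ν x)
    + (X1 A μ x * X2 U₀ A μ ν x + X1 A μ x * X3 U₀ A μ ν x + X1 A μ x * X4 A ν x
      + X2 U₀ A μ ν x * X3 U₀ A μ ν x + X2 U₀ A μ ν x * X4 A ν x + X3 U₀ A μ ν x * X4 A ν x)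

/-- `V₂ = Σᵢxᵢ² + 2Σ_{i<j}xᵢxⱼ` is twice the second-order term (the tree's `B8.v2_identity` rewrites it further as
`(Σᵢxᵢ)² + Σ_{i<j}[xᵢ, xⱼ]`, the second line of (1.49)). [cite: Balaban1985RegularSpaces, (1.49) p.85] -/
theorem V2_eq_two_smul_quad (U₀ : Site d → Fin d → 𝔸ˣ) (A : Site d → Fin d → 𝔸) (μ ν : Fin d) (x : Site d) :
    V2 U₀ A μ ν x = (2 : ℂ) • quad U₀ A μ ν x := by
  simp only [V2, quad, smul_add, smul_smul, mul_inv_cancel₀ (two_ne_zero (α := ℂ)), one_smul, two_smul,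
    two_mul]
  abel

/-- The exponent field scales the variables: `Xᵢ(cA) = cXᵢ(A)`. [folklore] -/
theorem lin_smul (U₀ : Site d → Fin d → 𝔸ˣ) (A : Site d → Fin d → 𝔸) (c : ℂ) (μ ν : Fin d) (x : Site d) :
    lin U₀ (fun y κ => c • A y κ) μ ν x = c • lin U₀ A μ ν x := by
  simp only [lin, X1, X2, X3, X4, ← smul_neg, conjR_smul, smul_add]

/-- `quad(cA) = c²·quad(A)`. [folklore] -/
theorem quad_smul (U₀ : Site d → Fin d → 𝔸ˣ) (A : Site d → Fin d → 𝔸) (c : ℂ) (μ ν : Fin d) (x : Site d) :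
    quad U₀ (fun y κ => c • A y κ) μ ν x = c ^ 2 • quad U₀ A μ ν x := by
  simp only [quad, X1, X2, X3, X4, ← smul_neg, conjR_smul, smul_mul_assoc, mul_smul_comm, smul_smul]
  module

/-- **(3.4) of [B9]** THE PLAQUETTE COVARIANT DERIVATIVE of a bond field, verbatim:
`(D^η_{U₀}A)(p) = η⁻¹(A(x, y) + R(U₀(x, y))A(y, z) + R(U₀(x, w))A(z, w) + A(w, x))`.
[cite: Balaban1985BackgroundPropagators, (3.4) p.391] -/
def plaqCovDeriv (η : ℝ) (U₀ : Site d → Fin d → 𝔸ˣ) (A : Site d → Fin d → 𝔸) (μ ν : Fin d) (x : Site d) : 𝔸 :=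
  η⁻¹ • lin U₀ A μ ν x

/-- **(3.4) of [B9]**, the other printed form, on the tree's forward derivative (1.1) (`B8Ineq132.covDerivFwd`):
`(D^η_{U₀}A)(p_{μν}(x)) = (D^η_{U₀,μ}A_ν)(x) − (D^η_{U₀,ν}A_μ)(x)`.
[cite: Balaban1985BackgroundPropagators, (3.4) p.391; Balaban1985RegularSpaces, (1.1) p.76] -/
theorem plaqCovDeriv_eq_covDerivFwd (η : ℝ) (U₀ : Site d → Fin d → 𝔸ˣ) (A : Site d → Fin d → 𝔸) (μ ν : Fin d)
    (x : Site d) : plaqCovDeriv η U₀ A μ ν x =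
      covDerivFwd η U₀ μ (fun y => A y ν) x - covDerivFwd η U₀ ν (fun y => A y μ) x := by
  simp only [plaqCovDeriv, covDerivFwd, lin, X1, X2, X3, X4, conjR_neg, ← smul_sub]
  congr 1
  abel

/-- `Σᵢxᵢ = η(D^η_{U₀}A)(p)` (the identification used in (1.49)–(1.50), cf. `B8.commutators_150`), `η ≠ 0`.
[cite: Balaban1985RegularSpaces, (1.49) p.85] -/
theorem lin_eq_smul_plaqCovDeriv {η : ℝ} (hη : η ≠ 0) (U₀ : Site d → Fin d → 𝔸ˣ) (A : Site d → Fin d → 𝔸)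
    (μ ν : Fin d) (x : Site d) : lin U₀ A μ ν x = η • plaqCovDeriv η U₀ A μ ν x := by
  rw [plaqCovDeriv, smul_smul, mul_inv_cancel₀ hη, one_smul]

/-- `ad_{cX} = c·ad_X`. [folklore] -/
theorem adR_smul_left (c : ℂ) (X Y : 𝔸) : adR (c • X) Y = c • adR X Y := by
  simp only [adR, smul_mul_assoc, mul_smul_comm, smul_sub]

/-- `ad_X(cY) = c·ad_X Y`. [folklore] -/
theorem adR_smul_right (c : ℂ) (X Y : 𝔸) : adR X (c • Y) = c • adR X Y := by
  simp only [adR, smul_mul_assoc, mul_smul_comm, smul_sub]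

/-- `ad_X(cY) = c·ad_X Y`, real scalar. [folklore] -/
theorem adR_smul_right_real (c : ℝ) (X Y : 𝔸) : adR X (c • Y) = c • adR X Y := by
  rw [← Complex.coe_smul, adR_smul_right, Complex.coe_smul]

omit [NormedAlgebra ℂ 𝔸] in
/-- `ad_{−X} = −ad_X`. [folklore] -/
theorem adR_neg_left (X Y : 𝔸) : adR (-X) Y = -adR X Y := by
  simp only [adR, neg_mul, mul_neg]
  abel

end Polys

/-! ## §3 (1.47): `(∂_{U₀}U₁)(p) = e^{X₁}e^{X₂}e^{X₃}e^{X₄}` and its expansion to the third order -/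

section Plaquette

variable {𝔸 : Type*} [NormedRing 𝔸] [NormedAlgebra ℂ 𝔸] [CompleteSpace 𝔸]

/-- (1.41) «U₁ = e^{iηA}»: the bond configuration `b ↦ e^{B_b}` of an exponent field `B` (print: `B = iηA`; §6).
[cite: Balaban1985RegularSpaces, (1.41) p.83] -/
def expCfg (B : Site d → Fin d → 𝔸) : Site d → Fin d → 𝔸ˣ := fun x μ => expUnit (B x μ)

/-- `|B_b| + |B_{b′}| + |B_{b″}| + |B_{b‴}|` over `∂p_{μν}(x)` — print's `η·∂|A|(p)` at `B = iηA`.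
[cite: Balaban1985RegularSpaces, (1.47) p.84 («∂|A|(p)»)] -/
def bdry (B : Site d → Fin d → 𝔸) (μ ν : Fin d) (x : Site d) : ℝ :=
  ‖B x μ‖ + ‖B (x + e μ) ν‖ + ‖B (x + e ν) μ‖ + ‖B x ν‖

/-- `(∂_{U₀}e^{B})(p_{μν}(x)) = e^{X₁}e^{X₂}·(e^{X₃}e^{X₄})` with `Xᵢ = Xᵢ(B)`: by (1.22) (`covPlaq = lead·trail`) and
`R(u)e^{X} = e^{R(u)X}`, `(e^{X})⁻¹ = e^{−X}`. [cite: Balaban1985RegularSpaces, (1.22) p.79, (1.47) p.84] -/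
theorem covPlaqF_expCfg (U₀ : Site d → Fin d → 𝔸ˣ) (B : Site d → Fin d → 𝔸) (μ ν : Fin d) (x : Site d) :
    covPlaqF U₀ (expCfg B) μ ν x =
      exp (X1 B μ x) * exp (X2 U₀ B μ ν x) * (exp (X3 U₀ B μ ν x) * exp (X4 B ν x)) := by
  simp only [covPlaqF, covPlaq, Units.val_mul, val_lead, val_trail, expCfg, val_inv_expUnit, val_expUnit,
    ← exp_conjR]
  rfl

variable [NormOneClass 𝔸]

/-- THE SECOND-ORDER TAYLOR DATA OF `(∂_{U₀}U₁)(p)`: for `U1`-valued `U₀`,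
`(∂_{U₀}e^{B})(p) = 1 + Σᵢxᵢ + (½Σᵢxᵢ² + Σ_{i<j}xᵢxⱼ) + O₁(ρ₃(s))`, `s = Σ_{b⊂∂p}|B_b|`, with
`|(∂_{U₀}e^B)(p) − 1| ≤ e^s − 1` and `|(∂_{U₀}e^B)(p) − 1 − Σᵢxᵢ| ≤ ρ(s)` on the way. [cite: Balaban1985RegularSpaces, (1.47) p.84] -/
theorem taylor_covPlaqF {U₀ : Site d → Fin d → 𝔸ˣ} (h₀ : ∀ y κ, U₀ y κ ∈ U1 𝔸) (B : Site d → Fin d → 𝔸)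
    (μ ν : Fin d) (x : Site d) :
    T2 (covPlaqF U₀ (expCfg B) μ ν x) (lin U₀ B μ ν x) (quad U₀ B μ ν x) (bdry B μ ν x) := by
  have h1 : T2 (exp (X1 B μ x)) (X1 B μ x) ((2 : ℂ)⁻¹ • (X1 B μ x * X1 B μ x)) ‖B x μ‖ := T2.exp le_rfl
  have h2 : T2 (exp (X2 U₀ B μ ν x)) (X2 U₀ B μ ν x) ((2 : ℂ)⁻¹ • (X2 U₀ B μ ν x * X2 U₀ B μ ν x))
      ‖B (x + e μ) ν‖ := T2.exp (norm_conjR_le (h₀ x μ) _)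
  have h3 : T2 (exp (X3 U₀ B μ ν x)) (X3 U₀ B μ ν x) ((2 : ℂ)⁻¹ • (X3 U₀ B μ ν x * X3 U₀ B μ ν x))
      ‖B (x + e ν) μ‖ := T2.exp ((norm_conjR_le (h₀ x ν) _).trans (norm_neg _).le)
  have h4 : T2 (exp (X4 B ν x)) (X4 B ν x) ((2 : ℂ)⁻¹ • (X4 B ν x * X4 B ν x)) ‖B x ν‖ :=
    T2.exp (norm_neg _).le
  have h := (h1.mul h2).mul (h3.mul h4)
  rw [covPlaqF_expCfg]
  refine h.congr ?_ ?_ ?_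
  · simp only [lin]
    abel
  · simp only [quad, smul_add, mul_add, add_mul]
    abel
  · simp only [bdry]
    ring

/-- The same with a UNIFORM bound `|B_b| ≤ a` on the four bonds: amplitude `4a` (print: `a = ηα₂(Lʲη)⁻¹`, so
`e^{4a} − 1 ≈ 4α₂(Lʲη)⁻¹η` = «∂_{U₀}U₁ − 1 = O₁(4α₂(Lʲη)⁻¹η)»). [cite: Balaban1985RegularSpaces, p.84] -/
theorem taylor_covPlaqF_unif {U₀ : Site d → Fin d → 𝔸ˣ} (h₀ : ∀ y κ, U₀ y κ ∈ U1 𝔸) {B : Site d → Fin d → 𝔸}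
    {a : ℝ} (hB : ∀ y κ, ‖B y κ‖ ≤ a) (μ ν : Fin d) (x : Site d) :
    T2 (covPlaqF U₀ (expCfg B) μ ν x) (lin U₀ B μ ν x) (quad U₀ B μ ν x) (4 * a) := by
  refine (taylor_covPlaqF h₀ B μ ν x).mono ?_
  unfold bdry
  linarith [hB x μ, hB (x + e μ) ν, hB (x + e ν) μ, hB x ν]

/-- **(1.47)** (sharp form): `|(∂_{U₀}e^B)(p) − 1 − Σᵢxᵢ − (½Σᵢxᵢ² + Σ_{i<j}xᵢxⱼ)| ≤ ρ₃(Σ_{b⊂∂p}|B_b|)` — at `B = iηA`: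
`(∂_{U₀}U₁)(p) − 1 = iη²(D^η_{U₀}A)(p) − ½η²V₂(U₀, A, ∂p) + O₁(ρ₃(η∂|A|(p)))`, `ρ₃(s) = s³/3! + …`.
[cite: Balaban1985RegularSpaces, (1.47) p.84] -/
theorem eq147 {U₀ : Site d → Fin d → 𝔸ˣ} (h₀ : ∀ y κ, U₀ y κ ∈ U1 𝔸) (B : Site d → Fin d → 𝔸) (μ ν : Fin d)
    (x : Site d) :
    ‖covPlaqF U₀ (expCfg B) μ ν x - 1 - lin U₀ B μ ν x - quad U₀ B μ ν x‖ ≤ expRem3 (bdry B μ ν x) :=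
  (taylor_covPlaqF h₀ B μ ν x).ord2

/-- «Similarly, if we take this term and expand ∂_{U₀}U₁ − 1, then it is enough to consider a term of the first
order only, a remainder is O₁((1/2!)η²(∂|A|(p))²)»: `|(∂_{U₀}e^B)(p) − 1 − Σᵢxᵢ| ≤ ρ(Σ_{b⊂∂p}|B_b|)`,
`ρ(s) = s²/2! + …`. [cite: Balaban1985RegularSpaces, p.84] -/
theorem eq147_ord1 {U₀ : Site d → Fin d → 𝔸ˣ} (h₀ : ∀ y κ, U₀ y κ ∈ U1 𝔸) (B : Site d → Fin d → 𝔸)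
    (μ ν : Fin d) (x : Site d) :
    ‖covPlaqF U₀ (expCfg B) μ ν x - 1 - lin U₀ B μ ν x‖ ≤ expRem (bdry B μ ν x) :=
  (taylor_covPlaqF h₀ B μ ν x).ord1

/-- «∂_{U₀}U₁ − 1 = O₁(4α₂(Lʲη)⁻¹η)» (from (1.41)): `|(∂_{U₀}e^B)(p) − 1| ≤ e^{4a} − 1` for `|B| ≤ a`.
[cite: Balaban1985RegularSpaces, p.84] -/
theorem norm_covPlaqF_expCfg_sub_one_le {U₀ : Site d → Fin d → 𝔸ˣ} (h₀ : ∀ y κ, U₀ y κ ∈ U1 𝔸)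
    {B : Site d → Fin d → 𝔸} {a : ℝ} (hB : ∀ y κ, ‖B y κ‖ ≤ a) (μ ν : Fin d) (x : Site d) :
    ‖covPlaqF U₀ (expCfg B) μ ν x - 1‖ ≤ Real.exp (4 * a) - 1 :=
  (taylor_covPlaqF_unif h₀ hB μ ν x).ord0

end Plaquette

/-! ## §4 (1.46): the expansion of `R(U₁(x, x − ηe_ν)) − 1` and of the correction terms of (1.45) -/

section Correction

variable {𝔸 : Type*} [NormedRing 𝔸] [NormedAlgebra ℂ 𝔸] [CompleteSpace 𝔸]

/-- «We expand R(U₁(x, x − ηe_ν)) − 1 in A»: `R(e^{−b})Y − Y = e^{−b}Ye^{b} − Y = −ad_b Y + O₁(ρ(2|b|)|Y|)`,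
with `|R(e^{−b})Y − Y| ≤ (e^{2|b|} − 1)|Y|` at order zero — «a remainder is O₁(3|ηA|²)» (`ρ(2β) ≤ 3β²`,
`expRem_le_three_quarters`), «The term of the first order is iη ad_{A(x,x−ηe_ν)}» (`b = iηA(x − ηe_ν, x) =
−iηA(x, x − ηe_ν)`). [cite: Balaban1985RegularSpaces, p.84] -/
theorem conj_exp_expansion {b Y : 𝔸} {β : ℝ} (hb : ‖b‖ ≤ β) :
    ‖exp (-b) * Y * exp b - Y‖ ≤ (Real.exp (2 * β) - 1) * ‖Y‖ ∧
      ‖exp (-b) * Y * exp b - Y - (Y * b - b * Y)‖ ≤ expRem (2 * β) * ‖Y‖ := by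
  have hb' : ‖-b‖ ≤ β := by rwa [norm_neg]
  obtain ⟨hp, hq⟩ := norm_exp_sub_one_le_of_norm_le hb
  obtain ⟨hp', hq'⟩ := norm_exp_sub_one_le_of_norm_le hb'
  have h0 : 0 ≤ Real.exp β - 1 := by
    have := Real.one_le_exp ((norm_nonneg b).trans hb); linarith
  constructor
  · have heq : exp (-b) * Y * exp b - Y = (exp (-b) - 1) * Y + Y * (exp b - 1) + (exp (-b) - 1) * Y * (exp b - 1) := by
      noncomm_ring
    rw [heq]
    calc _ ≤ ‖(exp (-b) - 1) * Y‖ + ‖Y * (exp b - 1)‖ + ‖(exp (-b) - 1) * Y * (exp b - 1)‖ := norm_add₃_le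
      _ ≤ ‖exp (-b) - 1‖ * ‖Y‖ + ‖Y‖ * ‖exp b - 1‖ + ‖exp (-b) - 1‖ * ‖Y‖ * ‖exp b - 1‖ := by
          gcongr
          · exact norm_mul_le _ _
          · exact norm_mul_le _ _
          · exact norm_mul₃_le
      _ ≤ (Real.exp β - 1) * ‖Y‖ + ‖Y‖ * (Real.exp β - 1) + (Real.exp β - 1) * ‖Y‖ * (Real.exp β - 1) := by
          gcongr
      _ = (Real.exp (2 * β) - 1) * ‖Y‖ := by rw [two_mul, Real.exp_add]; ring
  · have heq : exp (-b) * Y * exp b - Y - (Y * b - b * Y) =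
        (exp (-b) - 1 - -b) * Y + Y * (exp b - 1 - b) + (exp (-b) - 1) * Y * (exp b - 1) := by
      noncomm_ring
    rw [heq]
    calc _ ≤ ‖(exp (-b) - 1 - -b) * Y‖ + ‖Y * (exp b - 1 - b)‖ + ‖(exp (-b) - 1) * Y * (exp b - 1)‖ :=
          norm_add₃_le
      _ ≤ ‖exp (-b) - 1 - -b‖ * ‖Y‖ + ‖Y‖ * ‖exp b - 1 - b‖ + ‖exp (-b) - 1‖ * ‖Y‖ * ‖exp b - 1‖ := by
          gcongr
          · exact norm_mul_le _ _
          · exact norm_mul_le _ _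
          · exact norm_mul₃_le
      _ ≤ expRem β * ‖Y‖ + ‖Y‖ * expRem β + (Real.exp β - 1) * ‖Y‖ * (Real.exp β - 1) := by gcongr
      _ = expRem (2 * β) * ‖Y‖ := by rw [two_mul, expRem_add]; ring

/-- `R(U₁(x, x − e_ν))Y = e^{−b}Ye^{b}` for `U₁ = e^B`, `b = B(x − e_ν, ν)` (`U(x, x − e_ν) = U(x − e_ν, x)⁻¹`).
[cite: Balaban1985RegularSpaces, (1.45) p.84] -/
theorem conjR_expCfg_inv (B : Site d → Fin d → 𝔸) (y : Site d) (ν : Fin d) (Y : 𝔸) :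
    conjR (expCfg B y ν)⁻¹ Y = exp (-B y ν) * Y * exp (B y ν) := by
  simp only [expCfg, conjR_apply, val_inv_expUnit, val_expUnit, neg_neg]

variable [NormOneClass 𝔸]

/-- THE `ν`-TH CORRECTION TERM OF (1.45) EXPANDED: for `U1`-valued `U₀`, `U₁ = e^B`, `b = B(x − e_ν, ν)`,
`Z = G(x − e_ν) − 1` and ANY first-order proxy `L` of `Z`,
`|corr_ν(G)(x) − η⁻¹R(U₀(x, x − e_ν))(Lb − bL)| ≤ η⁻¹(2|b|·|Z − L| + ρ(2β)|Z|)` (`β ≥ |b|`): the product of the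
two first-order terms is kept, «it is enough to consider a term of the first order». [cite: Balaban1985RegularSpaces, (1.45)-(1.46) p.84] -/
theorem norm_corr_sub_main_le {η : ℝ} (hη : 0 < η) {U₀ : Site d → Fin d → 𝔸ˣ} {ν : Fin d} {x : Site d}
    (h₀ : U₀ (x - e ν) ν ∈ U1 𝔸) (B : Site d → Fin d → 𝔸) {β : ℝ} (hb : ‖B (x - e ν) ν‖ ≤ β)
    (G : Site d → 𝔸) (L : 𝔸) :
    ‖corr η U₀ (expCfg B) ν G x -
        η⁻¹ • conjR (U₀ (x - e ν) ν)⁻¹ (L * B (x - e ν) ν - B (x - e ν) ν * L)‖ ≤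
      η⁻¹ * (2 * ‖B (x - e ν) ν‖ * ‖G (x - e ν) - 1 - L‖ +
        expRem (2 * β) * ‖G (x - e ν) - 1‖) := by
  set b := B (x - e ν) ν
  set Z := G (x - e ν) - 1
  have hcorr : corr η U₀ (expCfg B) ν G x =
      η⁻¹ • conjR (U₀ (x - e ν) ν)⁻¹ (exp (-b) * Z * exp b - Z) := by
    simp only [corr, conjR_expCfg_inv, b, Z]
  rw [hcorr, ← smul_sub, ← conjR_sub, norm_smul, Real.norm_of_nonneg (inv_nonneg.mpr hη.le)]
  refine mul_le_mul_of_nonneg_left ?_ (inv_nonneg.mpr hη.le)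
  refine (norm_conjR_le ((U1 𝔸).inv_mem h₀) _).trans ?_
  have heq : exp (-b) * Z * exp b - Z - (L * b - b * L) =
      ((Z - L) * b - b * (Z - L)) + (exp (-b) * Z * exp b - Z - (Z * b - b * Z)) := by noncomm_ring
  rw [heq]
  refine (norm_add_le _ _).trans (add_le_add ?_ (conj_exp_expansion hb).2)
  calc ‖(Z - L) * b - b * (Z - L)‖ ≤ ‖(Z - L) * b‖ + ‖b * (Z - L)‖ := norm_sub_le _ _
    _ ≤ ‖Z - L‖ * ‖b‖ + ‖b‖ * ‖Z - L‖ := add_le_add (norm_mul_le _ _) (norm_mul_le _ _)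
    _ = 2 * ‖b‖ * ‖Z - L‖ := by ring

/-- THE MAIN TERM OF (1.46) at the bond `⟨x, x + e_μ⟩`:
`Σ_{ν≠μ} η⁻¹R(U₀(x, x − e_ν)) ad_{b_ν}(Σᵢxᵢ)(p_{μν}(x − e_ν))`, `b_ν = B(x − e_ν, ν)`; at `B = iηA` this is
print's `η²Σ_{ν≠μ}R(U₀(x, x − ηe_ν)) ad_{A(x,x−ηe_ν)}(D^η_{U₀}A)(p_{μν}(x − ηe_ν))` (`main146_printed`, §6).
[cite: Balaban1985RegularSpaces, (1.46) p.84] -/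
def main146 (η : ℝ) (U₀ : Site d → Fin d → 𝔸ˣ) (B : Site d → Fin d → 𝔸) (μ : Fin d) (x : Site d) : 𝔸 :=
  ∑ ν ∈ Finset.univ.erase μ,
    η⁻¹ • conjR (U₀ (x - e ν) ν)⁻¹ (adR (B (x - e ν) ν) (lin U₀ B μ ν (x - e ν)))

omit [NormedAlgebra ℂ 𝔸] [CompleteSpace 𝔸] [NormOneClass 𝔸] in
/-- `Σ_{ν≠μ} = Σ_{ν<μ} + Σ_{ν>μ}`. [folklore] -/
theorem sum_erase_eq_Iio_add_Ioi {M : Type*} [AddCommMonoid M] (μ : Fin d) (f : Fin d → M) :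
    ∑ ν ∈ Finset.univ.erase μ, f ν = ∑ ν ∈ Finset.Iio μ, f ν + ∑ ν ∈ Finset.Ioi μ, f ν := by
  rw [← Finset.sum_union]
  · congr 1
    ext ν
    simp [lt_or_lt_iff_ne]
  · exact Finset.disjoint_left.mpr fun ν h1 h2 => lt_asymm (Finset.mem_Iio.mp h1) (Finset.mem_Ioi.mp h2)

/-- The per-direction error function of (1.46): `Φ(a) = 2a·ρ(4a) + ρ(2a)(e^{4a} − 1) = 24a³ + O(a⁴)` (print: `28a³`,
see `phi146_le`). [cite: Balaban1985RegularSpaces, (1.46) p.84] -/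
def phi146 (a : ℝ) : ℝ := 2 * a * expRem (4 * a) + expRem (2 * a) * (Real.exp (4 * a) - 1)

/-- **(1.46)** (sharp form).  For `U1`-valued `U₀`, `U₁ = e^B` with `|B_b| ≤ a` on all bonds, `η > 0`:
`|(D^{η*}_{U₁U₀}∂_{U₀}U₁)(x, x + e_μ) − (D^{η*}_{U₀}(∂_{U₀}U₁ − 1))(x, x + e_μ) − main146| ≤ (d − 1)η⁻¹Φ(a)`,
by (1.45) (`eq145_covPlaq`), the expansion of each correction term (`norm_corr_sub_main_le` with the
first-order proxy `Σᵢxᵢ` of the neighbouring plaquette, `eq147_ord1`, antisymmetry `lin_swap`) and `d − 1`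
directions `ν ≠ μ`. [cite: Balaban1985RegularSpaces, (1.46) p.84] -/
theorem eq146 {η : ℝ} (hη : 0 < η) {U₀ : Site d → Fin d → 𝔸ˣ} (h₀ : ∀ y κ, U₀ y κ ∈ U1 𝔸)
    {B : Site d → Fin d → 𝔸} {a : ℝ} (hB : ∀ y κ, ‖B y κ‖ ≤ a) (μ : Fin d) (x : Site d) :
    ‖pdiv η (mulCfg (expCfg B) U₀) (covPlaqF U₀ (expCfg B)) μ x -
        pdiv η U₀ (covPlaqF U₀ (expCfg B) - 1) μ x - main146 η U₀ B μ x‖ ≤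
      ((d : ℝ) - 1) * (η⁻¹ * phi146 a) := by
  set U₁ := expCfg B
  set F := covPlaqF U₀ U₁
  have ha : 0 ≤ a := (norm_nonneg _).trans (hB x μ)
  -- the per-direction bound, for any plaquette function with the Taylor data of (1.47)
  have key : ∀ (ν : Fin d) (G : Site d → 𝔸) (L : 𝔸), ‖G (x - e ν) - 1‖ ≤ Real.exp (4 * a) - 1 →
      ‖G (x - e ν) - 1 - L‖ ≤ expRem (4 * a) →
      ‖corr η U₀ U₁ ν G x - η⁻¹ • conjR (U₀ (x - e ν) ν)⁻¹ (L * B (x - e ν) ν - B (x - e ν) ν * L)‖ ≤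
        η⁻¹ * phi146 a := by
    intro ν G L hG0 hG1
    refine (norm_corr_sub_main_le hη (h₀ _ _) B (hB _ _) G L).trans ?_
    refine mul_le_mul_of_nonneg_left ?_ (inv_nonneg.mpr hη.le)
    have n1 := expRem_nonneg (2 * a)
    have n2 := hB (x - e ν) ν
    unfold phi146
    gcongr
  -- the main summands, written with the first-order proxies of the neighbouring plaquettes
  set m : Fin d → 𝔸 := fun ν =>
    η⁻¹ • conjR (U₀ (x - e ν) ν)⁻¹ (adR (B (x - e ν) ν) (lin U₀ B μ ν (x - e ν)))
  have hm1 : ∀ ν, m ν = η⁻¹ • conjR (U₀ (x - e ν) ν)⁻¹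
      (lin U₀ B ν μ (x - e ν) * B (x - e ν) ν - B (x - e ν) ν * lin U₀ B ν μ (x - e ν)) := by
    intro ν
    simp only [m, adR, lin_swap U₀ B μ ν, neg_mul, mul_neg, sub_neg_eq_add]
    congr 2
    abel
  have hm2 : ∀ ν, -m ν = η⁻¹ • conjR (U₀ (x - e ν) ν)⁻¹
      (lin U₀ B μ ν (x - e ν) * B (x - e ν) ν - B (x - e ν) ν * lin U₀ B μ ν (x - e ν)) := by
    intro ν
    simp only [m, adR, ← smul_neg, ← conjR_neg, neg_sub]
  rw [eq145_covPlaq, add_sub_cancel_left, main146, sum_erase_eq_Iio_add_Ioi]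
  have heq : ∑ ν ∈ Finset.Iio μ, corr η U₀ U₁ ν (F ν μ) x - ∑ ν ∈ Finset.Ioi μ, corr η U₀ U₁ ν (F μ ν) x -
      (∑ ν ∈ Finset.Iio μ, m ν + ∑ ν ∈ Finset.Ioi μ, m ν) =
      ∑ ν ∈ Finset.Iio μ, (corr η U₀ U₁ ν (F ν μ) x - m ν) -
        ∑ ν ∈ Finset.Ioi μ, (corr η U₀ U₁ ν (F μ ν) x - -m ν) := by
    simp only [Finset.sum_sub_distrib, Finset.sum_neg_distrib]
    abel
  rw [heq]
  refine norm_sub_sums_le (fun ν _ => ?_) (fun ν _ => ?_)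
  · rw [hm1]
    exact key ν (F ν μ) _ (taylor_covPlaqF_unif h₀ hB ν μ (x - e ν)).ord0
      (taylor_covPlaqF_unif h₀ hB ν μ (x - e ν)).ord1
  · rw [hm2]
    exact key ν (F μ ν) _ (taylor_covPlaqF_unif h₀ hB μ ν (x - e ν)).ord0
      (taylor_covPlaqF_unif h₀ hB μ ν (x - e ν)).ord1

/-- The numerical side of print's `28`: `Φ(a) ≤ 28a³` for `0 ≤ a ≤ 1/16` (`Φ(a) = 24a³ + (464/9)a⁴ + …` from the
Taylor bounds with `n = 3`). [cite: Balaban1985RegularSpaces, (1.46) p.84] -/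
theorem phi146_le {a : ℝ} (ha : 0 ≤ a) (h16 : 16 * a ≤ 1) : phi146 a ≤ 28 * a ^ 3 := by
  have h4a0 : 0 ≤ 4 * a := by linarith
  have h4a1 : 4 * a ≤ 1 := by linarith
  have h2a0 : 0 ≤ 2 * a := by linarith
  have h2a1 : 2 * a ≤ 1 := by linarith
  have e1 := expRem_le_taylor3 h4a0 h4a1
  have e2 := expRem_le_taylor3 h2a0 h2a1
  have e3 := exp_sub_one_le_taylor3 h4a0 h4a1
  have n3 : 0 ≤ Real.exp (4 * a) - 1 := by have := Real.one_le_exp h4a0; linarith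
  have hA : 2 * a * expRem (4 * a) ≤ 2 * a * ((4 * a) ^ 2 / 2 + 2 / 9 * (4 * a) ^ 3) :=
    mul_le_mul_of_nonneg_left e1 h2a0
  have hB : expRem (2 * a) * (Real.exp (4 * a) - 1) ≤
      ((2 * a) ^ 2 / 2 + 2 / 9 * (2 * a) ^ 3) * (4 * a + (4 * a) ^ 2 / 2 + 2 / 9 * (4 * a) ^ 3) :=
    mul_le_mul e2 e3 n3 (by positivity)
  have pA : 2 * a * ((4 * a) ^ 2 / 2 + 2 / 9 * (4 * a) ^ 3) = 16 * a ^ 3 + 256 / 9 * a ^ 4 := by ring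
  have pB : ((2 * a) ^ 2 / 2 + 2 / 9 * (2 * a) ^ 3) * (4 * a + (4 * a) ^ 2 / 2 + 2 / 9 * (4 * a) ^ 3) =
      8 * a ^ 3 + 208 / 9 * a ^ 4 + 128 / 3 * a ^ 5 + 2048 / 81 * a ^ 6 := by ring
  rw [pA] at hA
  rw [pB] at hB
  have ha3 : 0 ≤ a ^ 3 := by positivity
  have hp4 : a ^ 4 ≤ a ^ 3 / 16 := by
    rw [show a ^ 4 = a * a ^ 3 by ring]; nlinarith
  have hp5 : a ^ 5 ≤ a ^ 3 / 256 := by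
    rw [show a ^ 5 = a * a ^ 4 by ring]; nlinarith
  have hp6 : a ^ 6 ≤ a ^ 3 / 4096 := by
    rw [show a ^ 6 = a * a ^ 5 by ring]; nlinarith
  unfold phi146
  linarith

end Correction

/-! ## §5 (1.48): the divergence of (1.47) -/

section Divergence148

variable {𝔸 : Type*} [NormedRing 𝔸] [NormOneClass 𝔸] [NormedAlgebra ℂ 𝔸] [CompleteSpace 𝔸]

/-- **(1.48)** (sharp form).  For `U1`-valued `U₀`, `U₁ = e^B`, `|B_b| ≤ a` on all bonds, `η > 0`:
`|D^{η*}_{U₀}(∂_{U₀}U₁ − 1)_μ(x) − D^{η*}_{U₀}(Σᵢxᵢ)_μ(x) − D^{η*}_{U₀}(½Σxᵢ² + Σ_{i<j}xᵢxⱼ)_μ(x)| ≤ 2(d − 1)η⁻¹ρ₃(4a)`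
— `D^{η*}_{U₀}` (the tree's `pdiv` = (1.2)) applied to (1.47), `d − 1` directions, `|D^{η*}_{U,ν}G(x)| ≤
η⁻¹(|G(x − e_ν)| + |G(x)|)`; at `B = iηA` the two subtracted terms are `iη²D^{η*}_{U₀}D^η_{U₀}A` and
`−½η²D^{η*}_{U₀}V₂(U₀, A)`. [cite: Balaban1985RegularSpaces, (1.48) p.84] -/
theorem eq148 {η : ℝ} (hη : 0 < η) {U₀ : Site d → Fin d → 𝔸ˣ} (h₀ : ∀ y κ, U₀ y κ ∈ U1 𝔸)
    {B : Site d → Fin d → 𝔸} {a : ℝ} (hB : ∀ y κ, ‖B y κ‖ ≤ a) (μ : Fin d) (x : Site d) :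
    ‖pdiv η U₀ (covPlaqF U₀ (expCfg B) - 1) μ x - pdiv η U₀ (lin U₀ B) μ x - pdiv η U₀ (quad U₀ B) μ x‖ ≤
      2 * ((d : ℝ) - 1) * η⁻¹ * expRem3 (4 * a) := by
  set R : Fin d → Fin d → Site d → 𝔸 := covPlaqF U₀ (expCfg B) - 1 - lin U₀ B - quad U₀ B with hR
  have hsplit : covPlaqF U₀ (expCfg B) - 1 = R + lin U₀ B + quad U₀ B := by simp only [hR]; abel
  have heq : pdiv η U₀ (covPlaqF U₀ (expCfg B) - 1) μ x - pdiv η U₀ (lin U₀ B) μ x - pdiv η U₀ (quad U₀ B) μ x =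
      pdiv η U₀ R μ x := by
    rw [hsplit, pdiv_add, pdiv_add]; abel
  have hRb : ∀ κ ν y, ‖R κ ν y‖ ≤ expRem3 (4 * a) := fun κ ν y => by
    simp only [hR, Pi.sub_apply, Pi.one_apply]
    exact (taylor_covPlaqF_unif h₀ hB κ ν y).ord2
  rw [heq]
  unfold pdiv
  calc _ ≤ ((d : ℝ) - 1) * (η⁻¹ * (expRem3 (4 * a) + expRem3 (4 * a))) := by
        refine norm_sub_sums_le (fun ν _ => ?_) (fun ν _ => ?_)
        · exact (norm_covDeriv_le hη (h₀ _ _) _).trans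
            (mul_le_mul_of_nonneg_left (add_le_add (hRb _ _ _) (hRb _ _ _)) (inv_nonneg.mpr hη.le))
        · exact (norm_covDeriv_le hη (h₀ _ _) _).trans
            (mul_le_mul_of_nonneg_left (add_le_add (hRb _ _ _) (hRb _ _ _)) (inv_nonneg.mpr hη.le))
    _ = 2 * ((d : ℝ) - 1) * η⁻¹ * expRem3 (4 * a) := by ring

end Divergence148

/-! ## §6 Print's letters and units: `B = iηA`, `|A| ≤ α₂(Lʲη)⁻¹`, and the printed constants
`3`, `2`, `28d`, `1/3!`, `(4³/3)d` -/

section Printed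

open Complex in
/-- `|iη·X| = η|X|` for `η ≥ 0`. [folklore] -/
theorem norm_I_eta_smul {𝔸 : Type*} [SeminormedAddCommGroup 𝔸] [NormedSpace ℂ 𝔸] {η : ℝ} (hη : 0 ≤ η)
    (X : 𝔸) : ‖((I : ℂ) * η) • X‖ = η * ‖X‖ := by
  rw [norm_smul, norm_mul, Complex.norm_I, one_mul, Complex.norm_real, Real.norm_of_nonneg hη]

/-- The unit bookkeeping of (1.46)–(1.48): `c(d − 1)η⁻¹(ηα₂r)³ ≤ c·d·α₂³r³η²` for `c ≥ 0`, `α₂r ≥ 0`, `η > 0`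
(`r = (Lʲη)⁻¹`). [folklore] -/
theorem units146 {c η α₂ r : ℝ} (hc : 0 ≤ c) (hη : 0 < η) (hαr : 0 ≤ α₂ * r) (d : ℕ) :
    c * ((d : ℝ) - 1) * (η⁻¹ * (η * α₂ * r) ^ 3) ≤ c * d * α₂ ^ 3 * r ^ 3 * η ^ 2 := by
  have h1 : η⁻¹ * η = 1 := inv_mul_cancel₀ hη.ne'
  have key : η⁻¹ * (η * α₂ * r) ^ 3 = (α₂ * r) ^ 3 * η ^ 2 := by
    calc η⁻¹ * (η * α₂ * r) ^ 3 = (η⁻¹ * η) * ((α₂ * r) ^ 3 * η ^ 2) := by ring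
      _ = (α₂ * r) ^ 3 * η ^ 2 := by rw [h1, one_mul]
  rw [key]
  have : 0 ≤ c * ((α₂ * r) ^ 3 * η ^ 2) := by positivity
  nlinarith

variable {𝔸 : Type*} [NormedRing 𝔸] [NormedAlgebra ℂ 𝔸]

/-- The exponent field of (1.41): `B = iηA` («U₁ = e^{iηA}»). [cite: Balaban1985RegularSpaces, (1.41) p.83] -/
def iEta (η : ℝ) (A : Site d → Fin d → 𝔸) : Site d → Fin d → 𝔸 := fun y κ => ((Complex.I : ℂ) * η) • A y κ

/-- Unfolding `B = iηA` under binders. [folklore] -/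
theorem iEta_def (η : ℝ) (A : Site d → Fin d → 𝔸) : iEta η A = fun y κ => ((Complex.I : ℂ) * η) • A y κ := rfl

/-- `|iηA_b| ≤ ηα₂(Lʲη)⁻¹` from «|A| < α₂(Lʲη)⁻¹» (1.41). [cite: Balaban1985RegularSpaces, (1.41) p.83] -/
theorem norm_iEta_le {η : ℝ} (hη : 0 ≤ η) {A : Site d → Fin d → 𝔸} {α : ℝ} (hA : ∀ y κ, ‖A y κ‖ ≤ α)
    (y : Site d) (κ : Fin d) : ‖iEta η A y κ‖ ≤ η * α := by
  rw [iEta, norm_I_eta_smul hη]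
  exact mul_le_mul_of_nonneg_left (hA y κ) hη

/-- «The term of the first order is iη²(D^η_{U₀}A)(p)»: `Σᵢxᵢ(iηA) = iη²(D^η_{U₀}A)(p_{μν}(x))`, `η ≠ 0`.
[cite: Balaban1985RegularSpaces, p.84 (line before (1.46))] -/
theorem lin_printed {η : ℝ} (hη : η ≠ 0) (U₀ : Site d → Fin d → 𝔸ˣ) (A : Site d → Fin d → 𝔸) (μ ν : Fin d)
    (x : Site d) :
    lin U₀ (iEta η A) μ ν x = ((Complex.I : ℂ) * η ^ 2) • plaqCovDeriv η U₀ A μ ν x := by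
  rw [iEta_def, lin_smul, lin_eq_smul_plaqCovDeriv hη, ← Complex.coe_smul, smul_smul]
  congr 1
  ring

/-- «− ½η²V₂(U₀, A, ∂p)»: the second-order term at `B = iηA` is `−½η²V₂`. [cite: Balaban1985RegularSpaces, (1.47) p.84] -/
theorem quad_printed (η : ℝ) (U₀ : Site d → Fin d → 𝔸ˣ) (A : Site d → Fin d → 𝔸) (μ ν : Fin d) (x : Site d) :
    quad U₀ (iEta η A) μ ν x = (-((η : ℂ) ^ 2) / 2) • V2 U₀ A μ ν x := by
  rw [iEta_def, quad_smul, V2_eq_two_smul_quad, smul_smul]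
  congr 1
  rw [mul_pow, Complex.I_sq]
  ring

/-- «The term of the first order is iη ad_{A(x,x−ηe_ν)} = O₁(2α₂(Lʲη)⁻¹η)»: with `A(x, x − ηe_ν) = −A_ν(x − ηe_ν)`
((3.5) of [B9]) and `|A_ν(x − ηe_ν)| ≤ α` (print: `α = α₂(Lʲη)⁻¹`), `|iη ad_{A(x,x−ηe_ν)}Y| ≤ 2αη|Y|`, `η ≥ 0`.
[cite: Balaban1985RegularSpaces, p.84] -/
theorem first_order_R_printed {η α : ℝ} (hη : 0 ≤ η) {Aν : 𝔸} (hA : ‖Aν‖ ≤ α) (Y : 𝔸) :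
    ‖((Complex.I : ℂ) * η) • adR (-Aν) Y‖ ≤ 2 * α * η * ‖Y‖ := by
  rw [norm_I_eta_smul hη]
  calc η * ‖adR (-Aν) Y‖ ≤ η * (2 * ‖-Aν‖ * ‖Y‖) := mul_le_mul_of_nonneg_left (norm_adR_le _ _) hη
    _ ≤ η * (2 * α * ‖Y‖) := by rw [norm_neg]; gcongr
    _ = 2 * α * η * ‖Y‖ := by ring

/-- (1.1) is `ℂ`-linear. [folklore] -/
theorem covDeriv_smul (η : ℝ) (V : Site d → Fin d → 𝔸ˣ) (ν : Fin d) (c : ℂ) (F : Site d → 𝔸) (x : Site d) :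
    covDeriv η V ν (c • F) x = c • covDeriv η V ν F x := by
  simp only [covDeriv, Pi.smul_apply, conjR_smul, ← smul_sub]
  exact smul_comm _ _ _

/-- (1.2) is `ℂ`-linear. [folklore] -/
theorem pdiv_smul (η : ℝ) (V : Site d → Fin d → 𝔸ˣ) (c : ℂ) (F : Fin d → Fin d → Site d → 𝔸) (μ : Fin d)
    (x : Site d) : pdiv η V (c • F) μ x = c • pdiv η V F μ x := by
  simp only [pdiv, Pi.smul_apply, covDeriv_smul, Finset.smul_sum, smul_sub]

variable [CompleteSpace 𝔸]

/-- «We expand R(U₁(x, x − ηe_ν)) − 1 in A … a remainder is O₁(3|ηA|²) … The term of the first order is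
iη ad_{A(x,x−ηe_ν)}»: for `U₁ = e^{iηA}`, the bond `b = ⟨y, y + e_ν⟩` (`y = x − e_ν`), `2η|A_b| ≤ 1`, `η ≥ 0`
and every `Y`: `|(R(U₁(x, x − e_ν)) − 1)Y − iη ad_{A(x,x−e_ν)}Y| ≤ 3(η|A_b|)²|Y|` (`A(x, x − e_ν) = −A_b`).
[cite: Balaban1985RegularSpaces, p.84] -/
theorem expansion_R_printed {η : ℝ} (hη : 0 ≤ η) (A : Site d → Fin d → 𝔸) (y : Site d) (ν : Fin d)
    (hsmall : 2 * (η * ‖A y ν‖) ≤ 1) (Y : 𝔸) :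
    ‖conjR (expCfg (iEta η A) y ν)⁻¹ Y - Y - ((Complex.I : ℂ) * η) • adR (-A y ν) Y‖ ≤
      3 * (η * ‖A y ν‖) ^ 2 * ‖Y‖ := by
  have hb : ‖iEta η A y ν‖ ≤ η * ‖A y ν‖ := (norm_I_eta_smul hη _).le
  have h := (conj_exp_expansion (Y := Y) hb).2
  rw [conjR_expCfg_inv]
  have heq : ((Complex.I : ℂ) * η) • adR (-A y ν) Y = Y * iEta η A y ν - iEta η A y ν * Y := by
    simp only [iEta, adR, smul_sub, smul_mul_assoc, mul_smul_comm, neg_mul, mul_neg, smul_neg]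
    abel
  rw [heq]
  refine h.trans (mul_le_mul_of_nonneg_right ?_ (norm_nonneg _))
  have h0 : 0 ≤ 2 * (η * ‖A y ν‖) := by positivity
  have := expRem_le_three_quarters h0 hsmall
  nlinarith

variable [NormOneClass 𝔸]

omit [CompleteSpace 𝔸] [NormOneClass 𝔸] in
/-- THE MAIN TERM OF (1.46) IN PRINT'S LETTERS, the sign included: at `B = iηA`,
`main146 = η²Σ_{ν≠μ}R(U₀(x, x − ηe_ν)) ad_{A(x,x−ηe_ν)}(D^η_{U₀}A)(p_{μν}(x − ηe_ν))` with `R(U₀(x, x − e_ν)) =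
R(U₀(x − e_ν, x)⁻¹)` and `A(x, x − ηe_ν) = −A_ν(x − ηe_ν)` ((3.5) of [B9]) — print's `+` is confirmed.
[cite: Balaban1985RegularSpaces, (1.46) p.84; Balaban1985BackgroundPropagators, (3.5) p.391] -/
theorem main146_printed (η : ℝ) (U₀ : Site d → Fin d → 𝔸ˣ) (A : Site d → Fin d → 𝔸) (μ : Fin d) (x : Site d) :
    main146 η U₀ (iEta η A) μ x = ((η : ℂ) ^ 2) • ∑ ν ∈ Finset.univ.erase μ,
      conjR (U₀ (x - e ν) ν)⁻¹ (adR (-A (x - e ν) ν) (plaqCovDeriv η U₀ A μ ν (x - e ν))) := by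
  simp only [main146, Finset.smul_sum]
  refine Finset.sum_congr rfl fun ν _ => ?_
  rw [iEta_def]
  simp only [lin_smul, adR_smul_left, adR_smul_right, smul_smul, conjR_smul, plaqCovDeriv, adR_neg_left,
    adR_smul_right_real, conjR_neg, conjR_smul_real, smul_neg]
  rw [← Complex.coe_smul, ← Complex.coe_smul, smul_smul, smul_smul, ← neg_smul]
  congr 1
  have hI : (Complex.I : ℂ) * η * ((Complex.I : ℂ) * η) = -((η : ℂ) ^ 2) := by
    calc (Complex.I : ℂ) * η * ((Complex.I : ℂ) * η) = (Complex.I * Complex.I) * (η : ℂ) ^ 2 := by ring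
      _ = -((η : ℂ) ^ 2) := by rw [Complex.I_mul_I]; ring
  rw [hI]
  push_cast
  ring

/-- **(1.46) IN PRINT'S UNITS.**  For `U1`-valued `U₀`, `U₁ = e^{iηA}` with `|A| ≤ α₂(Lʲη)⁻¹` on all bonds,
`α₂ ≥ 0`, `η > 0`, and the smallness `16α₂(Lʲη)⁻¹η ≤ 1`:
`|(D^{η*}_{U₁U₀}∂_{U₀}U₁)(x,x+ηe_μ) − (D^{η*}_{U₀}(∂_{U₀}U₁ − 1))(x,x+ηe_μ)
   − η²Σ_{ν≠μ}R(U₀(x,x−ηe_ν)) ad_{A(x,x−ηe_ν)}(D^η_{U₀}A)(p_{μν}(x−ηe_ν))| ≤ 28dα₂³(Lʲη)⁻³η²`.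
[cite: Balaban1985RegularSpaces, (1.46) p.84] -/
theorem eq146_printed {η : ℝ} (hη : 0 < η) {U₀ : Site d → Fin d → 𝔸ˣ} (h₀ : ∀ y κ, U₀ y κ ∈ U1 𝔸)
    {A : Site d → Fin d → 𝔸} {L j : ℕ} {α₂ : ℝ} (hα₂ : 0 ≤ α₂)
    (hA : ∀ y κ, ‖A y κ‖ ≤ α₂ * ((L : ℝ) ^ j * η)⁻¹) (hsmall : 16 * (α₂ * ((L : ℝ) ^ j * η)⁻¹ * η) ≤ 1)
    (μ : Fin d) (x : Site d) :
    ‖pdiv η (mulCfg (expCfg (iEta η A)) U₀) (covPlaqF U₀ (expCfg (iEta η A))) μ x -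
        pdiv η U₀ (covPlaqF U₀ (expCfg (iEta η A)) - 1) μ x -
        ((η : ℂ) ^ 2) • ∑ ν ∈ Finset.univ.erase μ,
          conjR (U₀ (x - e ν) ν)⁻¹ (adR (-A (x - e ν) ν) (plaqCovDeriv η U₀ A μ ν (x - e ν)))‖ ≤
      28 * d * α₂ ^ 3 * (((L : ℝ) ^ j * η)⁻¹) ^ 3 * η ^ 2 := by
  set r : ℝ := ((L : ℝ) ^ j * η)⁻¹
  have hr : 0 ≤ r := inv_nonneg.mpr (by positivity)
  have hB : ∀ y κ, ‖iEta η A y κ‖ ≤ η * α₂ * r := fun y κ =>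
    (norm_iEta_le hη.le hA y κ).trans_eq (by ring)
  have ha : 0 ≤ η * α₂ * r := by positivity
  have h16 : 16 * (η * α₂ * r) ≤ 1 := by linarith [hsmall, show 16 * (α₂ * r * η) = 16 * (η * α₂ * r) by ring]
  have hd1 : (1 : ℝ) ≤ d := Nat.one_le_cast.mpr (Fin.pos μ)
  rw [← main146_printed]
  refine (eq146 hη h₀ hB μ x).trans ?_
  calc ((d : ℝ) - 1) * (η⁻¹ * phi146 (η * α₂ * r))
      ≤ ((d : ℝ) - 1) * (η⁻¹ * (28 * (η * α₂ * r) ^ 3)) := by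
        have := phi146_le ha h16
        have hη' : 0 ≤ η⁻¹ := inv_nonneg.mpr hη.le
        have hd0 : 0 ≤ (d : ℝ) - 1 := by linarith
        exact mul_le_mul_of_nonneg_left (mul_le_mul_of_nonneg_left this hη') hd0
    _ = 28 * ((d : ℝ) - 1) * (η⁻¹ * (η * α₂ * r) ^ 3) := by ring
    _ ≤ 28 * d * α₂ ^ 3 * r ^ 3 * η ^ 2 := units146 (by norm_num) hη (mul_nonneg hα₂ hr) d

omit [NormOneClass 𝔸] [CompleteSpace 𝔸] in
/-- `η·∂|A|(p)`: the amplitude of the plaquette at `B = iηA` is `η(|A(x,y)| + |A(y,z)| + |A(z,w)| + |A(w,x)|)`, `η ≥ 0`.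
[cite: Balaban1985RegularSpaces, (1.47) p.84] -/
theorem bdry_iEta {η : ℝ} (hη : 0 ≤ η) (A : Site d → Fin d → 𝔸) (μ ν : Fin d) (x : Site d) :
    bdry (iEta η A) μ ν x = η * (‖A x μ‖ + ‖A (x + e μ) ν‖ + ‖A (x + e ν) μ‖ + ‖A x ν‖) := by
  simp only [bdry, iEta, norm_I_eta_smul hη]
  ring

/-- **(1.47) IN PRINT'S LETTERS.**  For `U1`-valued `U₀`, `U₁ = e^{iηA}`, `η > 0`, at a plaquette `p = p_{μν}(x)`
with `s = η∂|A|(p) = η(|A(x,y)| + |A(y,z)| + |A(z,w)| + |A(w,x)|) ≤ 1`: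
`|(∂_{U₀}U₁)(p) − 1 − iη²(D^η_{U₀}A)(p) + ½η²V₂(U₀, A, ∂p)| ≤ (1/3!)s³·(1 + (5/16)s)` — print's
`O₁((1/3!)η³(∂|A|(p))³)` with the next Taylor correction made explicit (`ρ₃(s) ≤ (s³/3!)(1 + 5s/16)` on `[0, 1]`).
[cite: Balaban1985RegularSpaces, (1.47) p.84] -/
theorem eq147_printed {η : ℝ} (hη : 0 < η) {U₀ : Site d → Fin d → 𝔸ˣ} (h₀ : ∀ y κ, U₀ y κ ∈ U1 𝔸)
    (A : Site d → Fin d → 𝔸) (μ ν : Fin d) (x : Site d)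
    (hs : η * (‖A x μ‖ + ‖A (x + e μ) ν‖ + ‖A (x + e ν) μ‖ + ‖A x ν‖) ≤ 1) :
    ‖covPlaqF U₀ (expCfg (iEta η A)) μ ν x - 1 - ((Complex.I : ℂ) * η ^ 2) • plaqCovDeriv η U₀ A μ ν x +
        ((η : ℂ) ^ 2 / 2) • V2 U₀ A μ ν x‖ ≤
      (η * (‖A x μ‖ + ‖A (x + e μ) ν‖ + ‖A (x + e ν) μ‖ + ‖A x ν‖)) ^ 3 / 6 *
        (1 + 5 / 16 * (η * (‖A x μ‖ + ‖A (x + e μ) ν‖ + ‖A (x + e ν) μ‖ + ‖A x ν‖))) := by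
  have h := eq147 h₀ (iEta η A) μ ν x
  rw [lin_printed hη.ne', quad_printed, bdry_iEta hη.le, neg_div, neg_smul, sub_neg_eq_add] at h
  exact h.trans (expRem3_le_taylor4 (by positivity) hs)

/-- «Similarly, if we take this term and expand ∂_{U₀}U₁ − 1, then it is enough to consider a term of the first
order only, a remainder is O₁((1/2!)η²(∂|A|(p))²) = O₁(8α₂²(Lʲη)⁻²η²). The term of the first order is
iη²(D^η_{U₀}A)(p).» IN PRINT'S LETTERS: for `U1`-valued `U₀`, `U₁ = e^{iηA}`, `η > 0`, `s = η∂|A|(p) ≤ 1`: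
`|(∂_{U₀}U₁)(p) − 1 − iη²(D^η_{U₀}A)(p)| ≤ (1/2!)s²·(1 + (4/9)s)` (and `(1/2!)s² ≤ 8α₂²(Lʲη)⁻²η²` when
`|A| ≤ α₂(Lʲη)⁻¹`, `s ≤ 4α₂(Lʲη)⁻¹η`). [cite: Balaban1985RegularSpaces, p.84] -/
theorem eq147_ord1_printed {η : ℝ} (hη : 0 < η) {U₀ : Site d → Fin d → 𝔸ˣ} (h₀ : ∀ y κ, U₀ y κ ∈ U1 𝔸)
    (A : Site d → Fin d → 𝔸) (μ ν : Fin d) (x : Site d)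
    (hs : η * (‖A x μ‖ + ‖A (x + e μ) ν‖ + ‖A (x + e ν) μ‖ + ‖A x ν‖) ≤ 1) :
    ‖covPlaqF U₀ (expCfg (iEta η A)) μ ν x - 1 - ((Complex.I : ℂ) * η ^ 2) • plaqCovDeriv η U₀ A μ ν x‖ ≤
      (η * (‖A x μ‖ + ‖A (x + e μ) ν‖ + ‖A (x + e ν) μ‖ + ‖A x ν‖)) ^ 2 / 2 *
        (1 + 4 / 9 * (η * (‖A x μ‖ + ‖A (x + e μ) ν‖ + ‖A (x + e ν) μ‖ + ‖A x ν‖))) := by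
  have h := eq147_ord1 h₀ (iEta η A) μ ν x
  rw [lin_printed hη.ne', bdry_iEta hη.le] at h
  refine h.trans ?_
  have h0 : 0 ≤ η * (‖A x μ‖ + ‖A (x + e μ) ν‖ + ‖A (x + e ν) μ‖ + ‖A x ν‖) := by positivity
  have := expRem_le_taylor3 h0 hs
  nlinarith

/-- «∂_{U₀}U₁ − 1 = O₁(4α₂(Lʲη)⁻¹η)» IN PRINT'S UNITS: for `U1`-valued `U₀`, `U₁ = e^{iηA}`, `|A| ≤ α₂(Lʲη)⁻¹` on the
bonds, `α₂ ≥ 0`, `η > 0`, `4α₂(Lʲη)⁻¹η ≤ 1`: `|(∂_{U₀}U₁)(p) − 1| ≤ 4α₂(Lʲη)⁻¹η·(1 + 3α₂(Lʲη)⁻¹η)` — print's `4`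
with the dropped factor `e^{O(α₂(Lʲη)⁻¹η)}` made explicit. [cite: Balaban1985RegularSpaces, p.84] -/
theorem norm_covPlaqF_sub_one_printed {η : ℝ} (hη : 0 < η) {U₀ : Site d → Fin d → 𝔸ˣ} (h₀ : ∀ y κ, U₀ y κ ∈ U1 𝔸)
    {A : Site d → Fin d → 𝔸} {L j : ℕ} {α₂ : ℝ} (hα₂ : 0 ≤ α₂)
    (hA : ∀ y κ, ‖A y κ‖ ≤ α₂ * ((L : ℝ) ^ j * η)⁻¹) (hsmall : 4 * (α₂ * ((L : ℝ) ^ j * η)⁻¹ * η) ≤ 1)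
    (μ ν : Fin d) (x : Site d) :
    ‖covPlaqF U₀ (expCfg (iEta η A)) μ ν x - 1‖ ≤
      4 * (α₂ * ((L : ℝ) ^ j * η)⁻¹ * η) * (1 + 3 * (α₂ * ((L : ℝ) ^ j * η)⁻¹ * η)) := by
  set r : ℝ := ((L : ℝ) ^ j * η)⁻¹
  have hr : 0 ≤ r := inv_nonneg.mpr (by positivity)
  have hB : ∀ y κ, ‖iEta η A y κ‖ ≤ α₂ * r * η := fun y κ =>
    (norm_iEta_le hη.le hA y κ).trans_eq (by ring)
  have ha : 0 ≤ α₂ * r * η := by positivity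
  refine (norm_covPlaqF_expCfg_sub_one_le h₀ hB μ ν x).trans ?_
  have := exp_le_taylor2 (by positivity : 0 ≤ 4 * (α₂ * r * η)) hsmall
  nlinarith

omit [CompleteSpace 𝔸] [NormOneClass 𝔸] in
/-- `Σᵢxᵢ(iηA) = iη²·D^η_{U₀}A` and `quad(iηA) = −½η²·V₂(U₀, A)` as plaquette functions. [cite: Balaban1985RegularSpaces, (1.47)-(1.48) p.84] -/
theorem lin_quad_iEta {η : ℝ} (hη : η ≠ 0) (U₀ : Site d → Fin d → 𝔸ˣ) (A : Site d → Fin d → 𝔸) :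
    lin U₀ (iEta η A) = ((Complex.I : ℂ) * η ^ 2) • plaqCovDeriv η U₀ A ∧
      quad U₀ (iEta η A) = (-((η : ℂ) ^ 2) / 2) • V2 U₀ A := by
  constructor
  · funext κ ν y
    simp only [Pi.smul_apply]
    exact lin_printed hη U₀ A κ ν y
  · funext κ ν y
    simp only [Pi.smul_apply]
    exact quad_printed η U₀ A κ ν y

/-- **(1.48) IN PRINT'S UNITS**, `d`-uniform form.  For `U1`-valued `U₀`, `U₁ = e^{iηA}`, `|A| ≤ α₂(Lʲη)⁻¹` on all
bonds, `α₂ ≥ 0`, `η > 0`, `4α₂(Lʲη)⁻¹η ≤ 1`: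
`|D^{η*}_{U₀}(∂_{U₀}U₁ − 1) − iη²D^{η*}_{U₀}D^η_{U₀}A + ½η²D^{η*}_{U₀}V₂(U₀, A)|
   ≤ (4³/3)(d − 1)(1 + (5/4)α₂(Lʲη)⁻¹η)·α₂³(Lʲη)⁻³η²` at every bond. [cite: Balaban1985RegularSpaces, (1.48) p.84] -/
theorem eq148_unif {η : ℝ} (hη : 0 < η) {U₀ : Site d → Fin d → 𝔸ˣ} (h₀ : ∀ y κ, U₀ y κ ∈ U1 𝔸)
    {A : Site d → Fin d → 𝔸} {L j : ℕ} {α₂ : ℝ} (hα₂ : 0 ≤ α₂)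
    (hA : ∀ y κ, ‖A y κ‖ ≤ α₂ * ((L : ℝ) ^ j * η)⁻¹) (hsmall : 4 * (α₂ * ((L : ℝ) ^ j * η)⁻¹ * η) ≤ 1)
    (μ : Fin d) (x : Site d) :
    ‖pdiv η U₀ (covPlaqF U₀ (expCfg (iEta η A)) - 1) μ x -
        ((Complex.I : ℂ) * η ^ 2) • pdiv η U₀ (plaqCovDeriv η U₀ A) μ x +
        ((η : ℂ) ^ 2 / 2) • pdiv η U₀ (V2 U₀ A) μ x‖ ≤
      4 ^ 3 / 3 * ((d : ℝ) - 1) * (1 + 5 / 4 * (α₂ * ((L : ℝ) ^ j * η)⁻¹ * η)) *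
        (α₂ ^ 3 * (((L : ℝ) ^ j * η)⁻¹) ^ 3 * η ^ 2) := by
  set r : ℝ := ((L : ℝ) ^ j * η)⁻¹
  have hr : 0 ≤ r := inv_nonneg.mpr (by positivity)
  have hB : ∀ y κ, ‖iEta η A y κ‖ ≤ η * α₂ * r := fun y κ =>
    (norm_iEta_le hη.le hA y κ).trans_eq (by ring)
  have ha : 0 ≤ η * α₂ * r := by positivity
  have h4 : 4 * (η * α₂ * r) ≤ 1 := by linarith [hsmall, show 4 * (α₂ * r * η) = 4 * (η * α₂ * r) by ring]
  have hd1 : (1 : ℝ) ≤ d := Nat.one_le_cast.mpr (Fin.pos μ)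
  have h := eq148 hη h₀ hB μ x
  obtain ⟨hlin, hquad⟩ := lin_quad_iEta hη.ne' U₀ A
  rw [hlin, hquad, pdiv_smul, pdiv_smul, neg_div, neg_smul, sub_neg_eq_add] at h
  refine h.trans ?_
  have hρ := expRem3_le_taylor4 (by positivity : 0 ≤ 4 * (η * α₂ * r)) h4
  have hc : 0 ≤ 2 * ((d : ℝ) - 1) * η⁻¹ := mul_nonneg (mul_nonneg zero_le_two (by linarith)) (inv_nonneg.mpr hη.le)
  have hu : α₂ ^ 3 * r ^ 3 * η ^ 2 = η⁻¹ * (η * α₂ * r) ^ 3 := by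
    rw [show (η * α₂ * r) ^ 3 = η * (η ^ 2 * (α₂ ^ 3 * r ^ 3)) by ring, ← mul_assoc, inv_mul_cancel₀ hη.ne',
      one_mul]
    ring
  calc 2 * ((d : ℝ) - 1) * η⁻¹ * expRem3 (4 * (η * α₂ * r))
      ≤ 2 * ((d : ℝ) - 1) * η⁻¹ * ((4 * (η * α₂ * r)) ^ 3 / 6 * (1 + 5 / 16 * (4 * (η * α₂ * r)))) :=
        mul_le_mul_of_nonneg_left hρ hc
    _ = 4 ^ 3 / 3 * ((d : ℝ) - 1) * (1 + 5 / 4 * (α₂ * r * η)) * (α₂ ^ 3 * r ^ 3 * η ^ 2) := by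
        rw [hu]; ring

/-- **(1.48) WITH PRINT'S CONSTANT `(4³/3)d`**: the `d − 1` directions and the factor `1 + (5/4)α₂(Lʲη)⁻¹η` of
`eq148_unif` are absorbed into print's `d` as soon as `5α₂(Lʲη)⁻¹η·(d − 1) ≤ 4` (e.g. for every `d ≤ 13` under
the smallness `16α₂(Lʲη)⁻¹η ≤ 1` of `eq146_printed`):
`|D^{η*}_{U₀}(∂_{U₀}U₁ − 1) − iη²D^{η*}_{U₀}D^η_{U₀}A + ½η²D^{η*}_{U₀}V₂(U₀, A)| ≤ (4³/3)dα₂³(Lʲη)⁻³η²`.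
[cite: Balaban1985RegularSpaces, (1.48) p.84] -/
theorem eq148_printed {η : ℝ} (hη : 0 < η) {U₀ : Site d → Fin d → 𝔸ˣ} (h₀ : ∀ y κ, U₀ y κ ∈ U1 𝔸)
    {A : Site d → Fin d → 𝔸} {L j : ℕ} {α₂ : ℝ} (hα₂ : 0 ≤ α₂)
    (hA : ∀ y κ, ‖A y κ‖ ≤ α₂ * ((L : ℝ) ^ j * η)⁻¹) (hsmall : 4 * (α₂ * ((L : ℝ) ^ j * η)⁻¹ * η) ≤ 1)
    (hd : 5 * (α₂ * ((L : ℝ) ^ j * η)⁻¹ * η) * ((d : ℝ) - 1) ≤ 4) (μ : Fin d) (x : Site d) :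
    ‖pdiv η U₀ (covPlaqF U₀ (expCfg (iEta η A)) - 1) μ x -
        ((Complex.I : ℂ) * η ^ 2) • pdiv η U₀ (plaqCovDeriv η U₀ A) μ x +
        ((η : ℂ) ^ 2 / 2) • pdiv η U₀ (V2 U₀ A) μ x‖ ≤
      4 ^ 3 / 3 * d * α₂ ^ 3 * (((L : ℝ) ^ j * η)⁻¹) ^ 3 * η ^ 2 := by
  refine (eq148_unif hη h₀ hα₂ hA hsmall μ x).trans ?_
  set r : ℝ := ((L : ℝ) ^ j * η)⁻¹
  have hr : 0 ≤ r := inv_nonneg.mpr (by positivity)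
  have hα : 0 ≤ α₂ ^ 3 * r ^ 3 * η ^ 2 := by positivity
  have hd1 : (1 : ℝ) ≤ d := Nat.one_le_cast.mpr (Fin.pos μ)
  have ha : 0 ≤ α₂ * r * η := by positivity
  have key : ((d : ℝ) - 1) * (1 + 5 / 4 * (α₂ * r * η)) ≤ d := by nlinarith
  calc 4 ^ 3 / 3 * ((d : ℝ) - 1) * (1 + 5 / 4 * (α₂ * r * η)) * (α₂ ^ 3 * r ^ 3 * η ^ 2)
      = 4 ^ 3 / 3 * (((d : ℝ) - 1) * (1 + 5 / 4 * (α₂ * r * η))) * (α₂ ^ 3 * r ^ 3 * η ^ 2) := by ring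
    _ ≤ 4 ^ 3 / 3 * (d : ℝ) * (α₂ ^ 3 * r ^ 3 * η ^ 2) := by gcongr
    _ = 4 ^ 3 / 3 * d * α₂ ^ 3 * r ^ 3 * η ^ 2 := by ring

end Printed

#print axioms T2.exp
#print axioms taylor_covPlaqF
#print axioms eq147
#print axioms eq146
#print axioms eq148
#print axioms main146_printed
#print axioms eq146_printed
#print axioms eq148_printed


end Literature.MathematicalPhysics.QuantumFieldTheory.Balaban1983to89.B8Eq146AExpansion

end
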